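import Literature.NumberTheory.Transcendental.BallRivoalLinearForms
import Literature.NumberTheory.Transcendental.OddZetaSeries
import Literature.NumberTheory.Irrationality.DirichletLValues.LinearIndependence
import HarnessLib

/-!
# Fischler–Sprang–Zudilin 2019, §§2–3: the twisted linear forms `r_{n,j}` and their arithmetic (Lemmas 1 and 2)

Topic `Literature/NumberTheory/Irrationality/FischlerSprangZudilin2019`, namespace
`Literature.NumberTheory.Irrationality.FischlerSprangZudilin2019` (the main theorem of the paper is the named
fact `manyOddZetaValuesIrrational` of `ManyOddZetaValues.lean`; §5 Lemma 4 is PROVED in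
`Literature/LinearAlgebra/Matrix/GeneralizedVandermonde.lean`). Source: S. Fischler, J. Sprang, W. Zudilin,
*Many odd zeta values are irrational*, Compositio Math. **155** (2019) 938–952 = arXiv:1803.08905
[FischlerSprangZudilin2019], §2 "Construction of linear forms" and §3 "Arithmetic estimates" (held:
`paper:arxiv-1803.08905`, arXiv text pp. 3–6, read on the page). EVERYTHING HERE IS PROVED (no named facts).

## The source, verbatim
§2: "From now on we let `s`, `D` be positive integers such that `s ≥ 3D`; we assume that `s` is odd. Let `n` be a
positive integer, such that `Dn` is even. Consider the following rational function:
`R_n(t) = D^{3Dn} n!^{s+1-3D} ∏_{j=0}^{3Dn} (t-n+j/D) / ∏_{j=0}^{n} (t+j)^{s+1}` … The rational function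
`R_n(t)` has a partial fraction expansion `R_n(t) = ∑_{i=1}^{s} ∑_{k=0}^{n} a_{i,k}/(t+k)^i` (2.1). For any
`j ∈ {1,…,D}`, take `r_{n,j} = ∑_{m=1}^{∞} R_n(m+j/D)`. … `ζ(i,α) = ∑_{n=0}^{∞} 1/(n+α)^i` …
**Lemma 1.** For each `j ∈ {1,…,D}`, we have `r_{n,j} = ρ_{0,j} + ∑_{3 ≤ i ≤ s, i odd} ρ_i ζ(i, j/D)`, where
`ρ_i = ∑_{k=0}^{n} a_{i,k}` for `3 ≤ i ≤ s`, `i` odd, does not depend on `j`, and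
`ρ_{0,j} = -∑_{k=0}^{n} ∑_{ℓ=0}^{k} ∑_{i=1}^{s} a_{i,k}/(ℓ+j/D)^i` (2.2)." (Proof: Lerch function and
`z → 1`, "`∑_k a_{1,k} = lim_{t→∞} t R_n(t) = 0`", and "Since `s` is odd and `Dn` is even we have
`R_n(-n-t) = -R_n(t)`. Now the partial fraction expansion (2.1) is unique, so that `a_{i,n-k} = (-1)^{i+1}a_{i,k}`
… This implies that `ρ_i = 0` when `i` is even".)
§3: "As usual we let `d_n = lcm(1,2,…,n)`. **Lemma 2.** We have `d_n^{s+1-i} ρ_i ∈ ℤ` for `i = 3, 5, …, s`,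
(3.1) and `d_{n+1}^{s+1} ρ_{0,j} ∈ ℤ` for any `j ∈ {1,…,D}` (3.2)." (Proof of (3.1): the bricks
`G(t) = n!/∏_{j=0}^{n}(t+j) = ∑_k (-1)^k C(n,k)/(t+k)` and `F_α(t) = Dⁿ∏_{j=1}^{n}(t+α+j/D)/∏_{j=0}^{n}(t+j)
= ∑_k A_{α,k}/(t+k)`, `A_{α,k} ∈ ℤ` by the printed three-case binomial formula, and
"`R_n(t) = (t-n) G(t)^{s+1-3D} ∏_{ℓ=0}^{3D-1} F_{-n+ℓn/D}(t)` (3.3) … A denominator appears each time the second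
rule is applied, and the denominator is always a divisor of `d_n` … `d_n^{s+1-i} a_{i,k} ∈ ℤ` for any `i` and
`k`". Proof of (3.2): `j = D` directly; for `1 ≤ j ≤ D-1`, "`R_n(ℓ₀-k₀+j/D) = 0`, so that
`∑_i d_{n+1}^{s+1}a_{i,k₀}/(ℓ₀+j/D)^i = -∑_{k≠k₀}∑_i d_{n+1}^{s+1}a_{i,k}/(ℓ₀-k₀+k+j/D)^i` (3.5) … there is at
least one term with negative `p`-adic valuation … `min(v_p(ℓ₀+j/D), v_p(ℓ₀-k₀+k₁+j/D)) > v_p(d_{n+1})` … we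
deduce that `v_p(k₀-k₁) > v_p(d_{n+1})`, which is impossible in view of the inequality `0 < |k₀-k₁| ≤ n`.")

## Rendering (tree vocabulary reused, nothing re-declared)
* `R s D n t` is `R_n(t) : ℚ → ℚ`. Partial fractions are the tree's
  `Literature.NumberTheory.Transcendental.BallRivoal.pfEval n K c t' = ∑_{p ≤ n} ∑_{o < K} c o p/(t'+p+1)^{o+1}`
  (poles at `-1, …, -(n+1)`), so we work in the variable `t' = t - 1` and with `K = s + 1` orders:
  `IsPF s D n c` says `pfEval n (s+1) c t' = R_n(t'+1)`; the dictionary is **`a_{i,k} = c (i-1) k`**. The source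
  writes the expansion up to `i = s`; we PROVE `a_{s+1,k} = 0` (`IsPF.top_eq_zero`), so nothing is changed.
* (3.3) is `R_eq_prod_brickEval`: `R_n(t'+1)` is the product of the `s+1` bricks `brick k D n σ` (`s = 3D+k`):
  `(t-n)G(t)` (residues `resGT`), `k` copies of `G` (tree `BallRivoal.resH`), and the `3D` bricks
  `F_{-n+ℓn/D}` (residues `resF D n e k = (-1)^k C(n,k)·C(e-Dk+n, n)` with `e = Dα ∈ ℤ` and Mathlib's
  integer-valued `Ring.choose` — the source's three-case formula for `A_{α,k}` in one piece). The tree's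
  `BallRivoal.exists_pf_prod` then yields (2.1) together with `d^{s+1-i}a_{i,k} ∈ ℤ` (`exists_isPF`,
  `IsPF.isInt_coeff`); uniqueness is the tree's `BallRivoal.pf_unique` (`IsPF.unique`).
* `rho n c i = ρ_i`, `rhoZero s D n c j = ρ_{0,j}` (written with `i = o+1` up to `s+1`; `= ` the printed sum by
  `rhoZero_eq_printed`), `r s D n j = r_{n,j} : ℝ`, `ζ(i, α)` = the tree's real Hurwitz value
  `Literature.NumberTheory.Irrationality.DirichletLValues.hurwitzValue i α = ∑_{ν ≥ 0} (ν+α)^{-i}`.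
* **Lemma 1** = `lemma1` (a `HasSum` over `m ≥ 0` of `R_n(m+1+j/D)`) and `r_eq`; the order-one terms are
  telescoped directly instead of passing through the Lerch function (same content: `∑_k a_{1,k} = 0`, which is
  `IsPF.sum_zero_eq_zero`, from the decay `|R_n(u)| ≤ C/u²`, `R_abs_le`); `R_reflect`, `IsPF.symm`,
  `IsPF.sum_eq_zero_of_odd` / `rho_eq_zero_of_even` are the symmetry steps.
* **Lemma 2** = `lemma2_rho` ((3.1), for every common multiple `d` of `1,…,n`, all `1 ≤ i ≤ s+1`) and
  `lemma2_rhoZero` ((3.2), for every common multiple `d` of `1,…,n+1`), with the printed `d_n`, `d_{n+1}`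
  (Mathlib `Nat.lcmUpto`) versions `lemma2_rho_lcm`, `lemma2_rhoZero_lcm`. The `p`-adic step is done with the
  elementary predicate `PIntegral p x` ("`p ∤ den x`"): `pIntegral_innerSum` (good points), `not_two_bad`
  (at most one bad point in a window of length `n`), `sum_innerSum_window_eq_zero` ((3.5)).

## Relation to the tree's `Transcendental/OddZeta*.lean` (same function, cruder arithmetic)
`Literature.NumberTheory.Transcendental.OddZeta.Rfun r D s n` (`OddZetaSeries.lean`, used by the elementary
Sprang-type proof `OddZetaFinal.lean` of "infinitely many odd zeta values are irrational") is the same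
rational function with the extra Ball–Rivoal parameter `r` of the source's Remark 1, over `ℝ`:
**`R_cast_eq_Rfun`: `(R s D n t : ℝ) = OddZeta.Rfun 1 D s n t`**, and `OddZeta.hz = hurwitzValue`
(`hz_eq_hurwitzValue`). That development proves Lemma 1/Lemma 2 in a deliberately cruder form
(`OddZeta.linear_forms`: symmetrised expansion, a factor `2`, denominators `d_{D(n+1)}`) and replaces Lemma 3
by sampling inequalities; the present file gives the statements AS PRINTED (`d_n`, `d_{n+1}`, no factor `2`,
uniqueness of (2.1), `a_{s+1,k} = 0`), which the count of Theorem 2 (`EliminationProof.lean`) uses.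

## Not here
Remark 2 (the `Φ_n(D)^{-1}` refinement of [RZnote], no definition printed), Lemma 3 (§4, asymptotics of
`r_{n,j}`) and the proof of Theorem 2 (§6) — see the sibling files of this directory. This file makes no
irrationality claim (cell zeta5-irr, rung F-Z1: nothing here bears on `ζ(5)`).
-/

noncomputable section

open Finset Filter Polynomial

open scoped BigOperators

namespace Literature.NumberTheory.Irrationality.FischlerSprangZudilin2019

open _root_.Topology
open Literature.NumberTheory.Transcendental (zetaValue)
open Literature.NumberTheory.Transcendental.BallRivoal (poch pfEval brickEval IsInt l1 resH lagrange_div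
  H_eq_brickEval exists_pf_prod pf_unique pfEval_reflect pfEval_sub' pfEval_const_mul pfEval_add
  tendsto_mul_pfEval)
open Literature.NumberTheory.Irrationality.DirichletLValues (hurwitzValue)

/-! ### §2: the rational function `R_n(t)` -/

/-- **The Fischler–Sprang–Zudilin rational function**
`R_n(t) = D^{3Dn} · n!^{s+1-3D} · ∏_{j=0}^{3Dn} (t - n + j/D) / ∏_{j=0}^{n} (t + j)^{s+1}`
(it "depends also on `s` and `D`"), as a function `ℚ → ℚ` of `t` (value `0` at the poles
`t = 0, -1, …, -n`, where the denominator vanishes). Standing hypotheses of the source: `s ≥ 3D`, `s` odd,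
`n ≥ 1`, `Dn` even. [cite: FischlerSprangZudilin2019, §2 (definition of R_n), arXiv:1803.08905 p. 3] -/
def R (s D n : ℕ) (t : ℚ) : ℚ :=
  (D : ℚ) ^ (3 * D * n) * (n.factorial : ℚ) ^ (s + 1 - 3 * D) *
      (∏ j ∈ range (3 * D * n + 1), (t - n + (j : ℚ) / D)) /
    (∏ j ∈ range (n + 1), (t + j)) ^ (s + 1)

/-- The denominator block `∏_{j=0}^{n} (t + 1 + j)` of `R_n(t+1)` is the tree's Pochhammer
`(t+1)_{n+1}`. [folklore] -/
private theorem prod_range_eq_poch (n : ℕ) (t : ℚ) :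
    ∏ j ∈ range (n + 1), (t + 1 + j) = poch (t + 1) (n + 1) := rfl

/-! ### §3, eq. (3.3): `R_n` as a product of `s + 1` "bricks" with integer residues

[FischlerSprangZudilin2019, §3 proof of Lemma 2]: with `G(t) = n!/∏_{j=0}^{n}(t+j) = ∑_k (-1)^k C(n,k)/(t+k)`
and `F_α(t) = Dⁿ ∏_{j=1}^{n} (t+α+j/D)/∏_{j=0}^{n}(t+j) = ∑_k A_{α,k}/(t+k)`, `A_{α,k} ∈ ℤ`, one has
`R_n(t) = (t-n) G(t)^{s+1-3D} ∏_{ℓ=0}^{3D-1} F_{-n+ℓn/D}(t)`. We use the tree's brick vocabulary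
(`Literature.NumberTheory.Transcendental.BallRivoal.brickEval n A t = ∑_{m ≤ n} A_m/(t+m+1)`, poles at
`-1, …, -(n+1)`), i.e. in the variable `t' = t - 1`, and absorb the factor `t - n` into the first copy of
`G` (for `n ≥ 1` this is again a brick). -/

/-- Residues of the brick `(t-n)·G(t) = n!(t-n)/∏_{j=0}^{n}(t+j)`: `(-1)^{m+1} C(n,m) (n+m)` at `t = -m`.
[cite: FischlerSprangZudilin2019, §3 proof of Lemma 2 (rule (t-n)/(t+k) = 1 - (k+n)/(t+k))] -/
def resGT (n m : ℕ) : ℤ := (-1) ^ (m + 1) * (n.choose m : ℤ) * (n + m)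

/-- Residues `A_{α,k}` of `F_α`, `α = e/D`: `A_{α,k} = (-1)^k C(n,k) · C(D(α-k)+n, n)` with the
generalized (integer-valued) binomial coefficient `C(r, n) = r(r-1)⋯(r-n+1)/n!`, `r = e - Dk + n ∈ ℤ`
(Mathlib's `Ring.choose` on the binomial ring `ℤ`); this is the source's three-case formula in one piece.
[cite: FischlerSprangZudilin2019, §3 proof of Lemma 2 (formula for A_{α,k})] -/
def resF (D n : ℕ) (e : ℤ) (m : ℕ) : ℤ :=
  (-1) ^ m * (n.choose m : ℤ) * Ring.choose (e - D * m + n : ℤ) n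

/-- The `s + 1 = (k+1) + 3D` bricks of `R_n` for `s = 3D + k`: `(t-n)G`, then `k` copies of `G`, then
`F_{-n+ℓn/D}` for `ℓ = 0, …, 3D-1` (`Dα = nℓ - Dn`). [cite: FischlerSprangZudilin2019, §3 eq. (3.3)] -/
def brick (k D n : ℕ) (σ : ℕ) : ℕ → ℤ :=
  if σ = 0 then resGT n else if σ ≤ k then resH n else resF D n ((n : ℤ) * ((σ - (k + 1) : ℕ) : ℤ) - D * n)

/-- `n! · C(r, n) = r (r-1) ⋯ (r-n+1)` in `ℚ`, for every integer `r`. [folklore] -/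
private theorem factorial_mul_ringChoose (r : ℤ) (n : ℕ) :
    (n.factorial : ℚ) * ((Ring.choose r n : ℤ) : ℚ) = ∏ j ∈ range n, ((r : ℚ) - j) := by
  have h := Ring.descPochhammer_eq_factorial_smul_choose r n
  rw [← Polynomial.eval_eq_smeval, descPochhammer_eval_eq_prod_range, nsmul_eq_mul] at h
  have h' := congrArg (fun z : ℤ => (z : ℚ)) h
  push_cast at h'
  rw [← h']

/-- `∏_{j < a b} f(j) = ∏_{ℓ<a} ∏_{j<b} f(ℓ b + j)`. [folklore] -/
private theorem prod_range_mul_blocks {M : Type*} [CommMonoid M] (f : ℕ → M) (a b : ℕ) :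
    ∏ j ∈ range (a * b), f j = ∏ ℓ ∈ range a, ∏ j ∈ range b, f (ℓ * b + j) := by
  induction a with
  | zero => simp
  | succ a ih => rw [Nat.succ_mul, prod_range_add, ih, prod_range_succ]

/-- The brick `(t-n)G(t)` at `t = t'+1`: `n!(t'+1-n)/(t'+1)_{n+1} = ∑_m resGT(n,m)/(t'+m+1)` (`n ≥ 1`).
[cite: FischlerSprangZudilin2019, §3 proof of Lemma 2] -/
theorem GT_eq_brickEval (n : ℕ) (hn : 1 ≤ n) (t : ℚ) (ht : ∀ m, m ≤ n → t + m + 1 ≠ 0) :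
    (n.factorial : ℚ) * (t + 1 - n) / poch (t + 1) (n + 1) = brickEval n (resGT n) t := by
  set P : ℚ[X] := C (n.factorial : ℚ) * (X + C (1 - (n : ℚ))) with hP
  have hdeg : P.degree < ((n + 1 : ℕ) : WithBot ℕ) := by
    have h1 : P.natDegree ≤ n := by
      rw [hP]
      refine (natDegree_C_mul_le _ _).trans ?_
      rw [natDegree_X_add_C]
      exact hn
    exact lt_of_le_of_lt (degree_le_of_natDegree_le h1) (by exact_mod_cast Nat.lt_succ_self n)
  have h := lagrange_div n P hdeg t ht
  have hev : ∀ u : ℚ, P.eval u = (n.factorial : ℚ) * (u + 1 - n) := by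
    intro u
    simp only [hP, eval_mul, eval_C, eval_add, eval_X]
    ring
  rw [hev] at h
  rw [h, brickEval]
  refine sum_congr rfl fun m hm => ?_
  have hm' : m ≤ n := Nat.lt_succ_iff.1 (mem_range.1 hm)
  rw [hev, resGT]
  push_cast
  rw [Nat.cast_choose ℚ hm']
  have hf : ((m.factorial : ℚ) * (n - m).factorial) ≠ 0 := by positivity
  field_simp
  ring

/-- The brick `F_α` at `t = t'+1`, `α = e/D`:
`∏_{j<n} (D(t'+1) + e + j + 1)/(t'+1)_{n+1} = ∑_m resF(D,n,e,m)/(t'+m+1)` (for `D ≠ 0` the left side is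
`Dⁿ∏_{j=1}^{n}(t'+1+α+j/D)/∏_{j=0}^{n}(t'+1+j) = F_α(t'+1)`).
[cite: FischlerSprangZudilin2019, §3 proof of Lemma 2 (F_α and A_{α,k})] -/
theorem F_eq_brickEval (D n : ℕ) (e : ℤ) (t : ℚ) (ht : ∀ m, m ≤ n → t + m + 1 ≠ 0) :
    (∏ j ∈ range n, ((D : ℚ) * (t + 1) + e + (j + 1))) / poch (t + 1) (n + 1) =
      brickEval n (resF D n e) t := by
  set P : ℚ[X] := ∏ j ∈ range n, (C (D : ℚ) * X + C ((D : ℚ) + e + (j + 1))) with hP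
  have hdeg : P.degree < ((n + 1 : ℕ) : WithBot ℕ) := by
    have h1 : P.natDegree ≤ n := by
      rw [hP]
      have h2 : ∀ j ∈ range n, (C (D : ℚ) * X + C ((D : ℚ) + e + (j + 1))).natDegree ≤ 1 :=
        fun j _ => natDegree_linear_le
      refine (natDegree_prod_le _ _).trans ((sum_le_sum h2).trans ?_)
      simp
    exact lt_of_le_of_lt (degree_le_of_natDegree_le h1) (by exact_mod_cast Nat.lt_succ_self n)
  have hev : ∀ u : ℚ, P.eval u = ∏ j ∈ range n, ((D : ℚ) * (u + 1) + e + (j + 1)) := by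
    intro u
    rw [hP, eval_prod]
    refine prod_congr rfl fun j _ => ?_
    simp only [eval_add, eval_mul, eval_C, eval_X]
    ring
  have h := lagrange_div n P hdeg t ht
  rw [hev] at h
  rw [h, brickEval]
  refine sum_congr rfl fun m hm => ?_
  have hm' : m ≤ n := Nat.lt_succ_iff.1 (mem_range.1 hm)
  rw [hev, resF]
  -- the numerator value is `∏_{j<n} (r - j)`, `r = e - Dm + n`, read backwards
  have hnum : ∏ j ∈ range n, ((D : ℚ) * (-(m : ℚ) - 1 + 1) + e + (j + 1)) =
      ∏ j ∈ range n, (((e - D * m + n : ℤ) : ℚ) - j) := by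
    rw [← prod_range_reflect]
    refine prod_congr rfl fun j hj => ?_
    have hj' : j < n := mem_range.1 hj
    have hc : ((n - 1 - j : ℕ) : ℚ) = (n : ℚ) - 1 - j := by
      rw [Nat.cast_sub (by omega : j ≤ n - 1), Nat.cast_sub (by omega : 1 ≤ n)]
      push_cast
      ring
    rw [hc]
    push_cast
    ring
  rw [hnum, ← factorial_mul_ringChoose]
  push_cast
  rw [Nat.cast_choose ℚ hm']
  have hf : ((m.factorial : ℚ) * (n - m).factorial) ≠ 0 := by positivity
  field_simp

/-- **Eq. (3.3) of the source in brick form**: for `s = 3D + k`, `n ≥ 1`, `D ≥ 1` and `t'` off the poles,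
`R_n(t'+1) = ∏_{σ ≤ s} B_σ(t')` with the bricks `brick k D n σ`.
[cite: FischlerSprangZudilin2019, §3 eq. (3.3)] -/
theorem R_eq_prod_brickEval (k D n : ℕ) (hn : 1 ≤ n) (hD : 1 ≤ D) (t : ℚ)
    (ht : ∀ m, m ≤ n → t + m + 1 ≠ 0) :
    R (3 * D + k) D n (t + 1) = ∏ σ ∈ range (3 * D + k + 1), brickEval n (brick k D n σ) t := by
  have hP : poch (t + 1) (n + 1) ≠ 0 := by
    rw [poch]
    exact prod_ne_zero_iff.2 fun m hm => by
      rw [add_right_comm]; exact ht m (Nat.lt_succ_iff.1 (mem_range.1 hm))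
  have hD0 : (D : ℚ) ≠ 0 := by exact_mod_cast (by omega : D ≠ 0)
  -- the right-hand side, brick by brick
  have hb0 : brick k D n 0 = resGT n := by simp [brick]
  have hb1 : ∀ σ, σ < k → brick k D n (σ + 1) = resH n := by
    intro σ hσ
    simp [brick, show σ + 1 ≤ k by omega]
  have hb2 : ∀ ℓ, brick k D n (k + 1 + ℓ) = resF D n ((n : ℤ) * ℓ - D * n) := by
    intro ℓ
    simp [brick, show ¬ (k + 1 + ℓ ≤ k) by omega, show k + 1 + ℓ - (k + 1) = ℓ by omega]
  have hsplit : ∏ σ ∈ range (3 * D + k + 1), brickEval n (brick k D n σ) t =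
      brickEval n (resGT n) t * (brickEval n (resH n) t) ^ k *
        ∏ ℓ ∈ range (3 * D), brickEval n (resF D n ((n : ℤ) * ℓ - D * n)) t := by
    rw [show 3 * D + k + 1 = (k + 1) + 3 * D by ring, prod_range_add, prod_range_succ', hb0,
      prod_congr rfl (fun σ hσ => by rw [hb1 σ (mem_range.1 hσ)]),
      prod_congr rfl (fun ℓ (_ : ℓ ∈ range (3 * D)) => by rw [hb2 ℓ]), prod_const, card_range]
    ring
  -- the `F`-bricks' numerators, factor by factor
  have hF : ∀ ℓ ∈ range (3 * D), brickEval n (resF D n ((n : ℤ) * ℓ - D * n)) t =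
      (∏ j ∈ range n, ((D : ℚ) * (t + 1 - n + ((ℓ * n + j + 1 : ℕ) : ℚ) / D))) /
        poch (t + 1) (n + 1) := by
    intro ℓ _
    rw [← F_eq_brickEval D n _ t ht]
    congr 1
    refine prod_congr rfl fun j _ => ?_
    push_cast
    field_simp
    ring
  have hDpow : ∏ ℓ ∈ range (3 * D), ∏ j ∈ range n,
      ((D : ℚ) * (t + 1 - n + ((ℓ * n + j + 1 : ℕ) : ℚ) / D)) =
      (D : ℚ) ^ (3 * D * n) * ∏ ℓ ∈ range (3 * D), ∏ j ∈ range n,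
        (t + 1 - n + ((ℓ * n + j + 1 : ℕ) : ℚ) / D) := by
    simp_rw [prod_mul_distrib, prod_const, card_range]
    rw [← pow_mul, mul_comm n]
  have hFprod : ∏ ℓ ∈ range (3 * D), brickEval n (resF D n ((n : ℤ) * ℓ - D * n)) t =
      (D : ℚ) ^ (3 * D * n) * (∏ ℓ ∈ range (3 * D), ∏ j ∈ range n,
        (t + 1 - n + ((ℓ * n + j + 1 : ℕ) : ℚ) / D)) / poch (t + 1) (n + 1) ^ (3 * D) := by
    rw [prod_congr rfl hF, prod_div_distrib, prod_const, card_range, hDpow]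
  -- the numerator of `R_n(t+1)`, regrouped
  have hnum : ∏ j ∈ range (3 * D * n + 1), (t + 1 - n + (j : ℚ) / D) =
      (t + 1 - n) * ∏ ℓ ∈ range (3 * D), ∏ j ∈ range n,
        (t + 1 - n + ((ℓ * n + j + 1 : ℕ) : ℚ) / D) := by
    rw [prod_range_succ', prod_range_mul_blocks]
    simp only [Nat.cast_zero, zero_div, add_zero]
    rw [mul_comm]
  rw [hsplit, ← GT_eq_brickEval n hn t ht, ← H_eq_brickEval n t ht, hFprod, R, hnum,
    prod_range_eq_poch, show 3 * D + k + 1 - 3 * D = k + 1 by omega]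
  generalize (∏ ℓ ∈ range (3 * D), ∏ j ∈ range n, (t + 1 - n + ((ℓ * n + j + 1 : ℕ) : ℚ) / D)) = Y
  generalize poch (t + 1) (n + 1) = P at hP ⊢
  rw [div_pow]
  field_simp
  ring

/-! ### The partial-fraction expansion (2.1): existence, integrality (3.1), uniqueness -/

/-- **Partial-fraction data of `R_n`** (eq. (2.1) of the source, `R_n(t) = ∑_{i=1}^{s}∑_{k=0}^{n} a_{i,k}/(t+k)^i`),
in the tree's `pfEval` format: `c o p = a_{o+1,p}` is the coefficient of `1/(t+p)^{o+1}`, orders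
`o + 1 = 1, …, s + 1` (the source stops at `i = s`: `a_{s+1,k} = 0` because the numerator of `R_n` vanishes
at every pole — these top coefficients are carried along here, harmlessly), and the identity
`∑_{p ≤ n} ∑_{o ≤ s} c_{o,p}/(t'+p+1)^{o+1} = R_n(t'+1)` holds for every `t'` off the poles.
[cite: FischlerSprangZudilin2019, §2 eq. (2.1)] -/
def IsPF (s D n : ℕ) (c : ℕ → ℕ → ℚ) : Prop :=
  ∀ t : ℚ, (∀ m, m ≤ n → t + m + 1 ≠ 0) → pfEval n (s + 1) c t = R s D n (t + 1)

/-- **Existence of the expansion (2.1) together with the arithmetic (3.1) at coefficient level**: for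
`s ≥ 3D`, `n, D ≥ 1` and any common multiple `d` of `1, …, n` there are partial-fraction data `c` of
`R_n` with `d^{s-o} c_{o,p} ∈ ℤ`, i.e. `d_n^{s+1-i} a_{i,k} ∈ ℤ` ("A denominator appears each time the
second rule is applied … This happens `s+1-i` times"; tree: `BallRivoal.exists_pf_prod`).
[cite: FischlerSprangZudilin2019, §3 proof of Lemma 2 (d_n^{s+1-i} a_{i,k} ∈ ℤ)] -/
theorem exists_isPF (s D n d : ℕ) (h3D : 3 * D ≤ s) (hn : 1 ≤ n) (hD : 1 ≤ D)
    (hdiv : ∀ k : ℕ, 1 ≤ k → k ≤ n → (k : ℤ) ∣ d) :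
    ∃ c : ℕ → ℕ → ℚ, IsPF s D n c ∧ IsInt (s + 1) d c := by
  obtain ⟨k, rfl⟩ := Nat.exists_eq_add_of_le h3D
  obtain ⟨c, hc, hint, -⟩ := exists_pf_prod n d hdiv (brick k D n) (3 * D + k + 1) (by omega)
  exact ⟨c, fun t ht => by rw [hc t ht, R_eq_prod_brickEval k D n hn hD t ht], hint⟩

/-- **Uniqueness of the expansion (2.1)** ("the partial fraction expansion (2.1) is unique"): two
partial-fraction data of `R_n` agree on the support `o ≤ s`, `p ≤ n`.
[cite: FischlerSprangZudilin2019, §2 proof of Lemma 1] -/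
theorem IsPF.unique {s D n : ℕ} {c c' : ℕ → ℕ → ℚ} (hc : IsPF s D n c) (hc' : IsPF s D n c')
    (o p : ℕ) (ho : o ≤ s) (hp : p ≤ n) : c o p = c' o p := by
  have h := pf_unique n (s + 1) (fun o p => c o p - c' o p) 0 (fun t _ => by
    have ht : ∀ m, m ≤ n → (t : ℚ) + m + 1 ≠ 0 := fun m _ => by positivity
    rw [pfEval_sub', hc t ht, hc' t ht, sub_self]) o p (by omega) hp
  exact sub_eq_zero.1 h

/-- **Lemma 2, (3.1), coefficientwise**: for ANY partial-fraction data of `R_n` (they are unique) and any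
common multiple `d` of `1, …, n`: `d^{s-o} c_{o,p} ∈ ℤ`, i.e. `d_n^{s+1-i} a_{i,k} ∈ ℤ` for all `i, k`.
[cite: FischlerSprangZudilin2019, §3 Lemma 2 (proof: d_n^{s+1-i} a_{i,k} ∈ ℤ)] -/
theorem IsPF.isInt_coeff {s D n : ℕ} {c : ℕ → ℕ → ℚ} (hc : IsPF s D n c) (h3D : 3 * D ≤ s)
    (hn : 1 ≤ n) (hD : 1 ≤ D) (d : ℕ) (hdiv : ∀ k : ℕ, 1 ≤ k → k ≤ n → (k : ℤ) ∣ d)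
    (o p : ℕ) (ho : o ≤ s) (hp : p ≤ n) : ∃ z : ℤ, (d : ℚ) ^ (s - o) * c o p = z := by
  obtain ⟨c', hc', hint⟩ := exists_isPF s D n d h3D hn hD hdiv
  obtain ⟨z, hz⟩ := hint o p
  refine ⟨z, ?_⟩
  rw [hc.unique hc' o p ho hp, ← hz, show s + 1 - 1 - o = s - o by omega]

/-! ### The reflection `t ↦ -n-t` and the vanishing of the even coefficients -/

/-- **`R_n(-n-t) = -R_n(t)`** for `s` odd and `Dn` even ("Since `s` is odd and `Dn` is even we have
`R_n(-n-t) = -R_n(t)`"). Valid at every rational `t` (at the poles both sides are the junk value `0`).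
[cite: FischlerSprangZudilin2019, §2 proof of Lemma 1] -/
theorem R_reflect (s D n : ℕ) (hs : Odd s) (hDn : Even (D * n)) (hD : 1 ≤ D) (u : ℚ) :
    R s D n (-(n : ℚ) - u) = -R s D n u := by
  have hD0 : (D : ℚ) ≠ 0 := by exact_mod_cast (by omega : D ≠ 0)
  have hnum : ∏ j ∈ range (3 * D * n + 1), (-(n : ℚ) - u - n + (j : ℚ) / D) =
      (-1) ^ (3 * D * n + 1) * ∏ j ∈ range (3 * D * n + 1), (u - n + (j : ℚ) / D) := by
    have hterm : ∀ j ∈ range (3 * D * n + 1), (-(n : ℚ) - u - n + (j : ℚ) / D) =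
        -((fun i : ℕ => u - n + (i : ℚ) / D) (3 * D * n + 1 - 1 - j)) := by
      intro j hj
      have hj' : j ≤ 3 * D * n := by have := mem_range.1 hj; omega
      simp only [show 3 * D * n + 1 - 1 - j = 3 * D * n - j by omega, Nat.cast_sub hj']
      push_cast
      field_simp
      ring
    rw [prod_congr rfl hterm, prod_neg, card_range,
      prod_range_reflect (fun i : ℕ => u - n + (i : ℚ) / D) (3 * D * n + 1)]
  have hden : ∏ j ∈ range (n + 1), (-(n : ℚ) - u + j) = (-1) ^ (n + 1) * ∏ j ∈ range (n + 1), (u + j) := by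
    have hterm : ∀ j ∈ range (n + 1), (-(n : ℚ) - u + j) =
        -((fun i : ℕ => u + (i : ℚ)) (n + 1 - 1 - j)) := by
      intro j hj
      have hj' : j ≤ n := by have := mem_range.1 hj; omega
      simp only [show n + 1 - 1 - j = n - j by omega, Nat.cast_sub hj']
      ring
    rw [prod_congr rfl hterm, prod_neg, card_range, prod_range_reflect (fun i : ℕ => u + (i : ℚ)) (n + 1)]
  have h1 : ((-1 : ℚ) ^ (n + 1)) ^ (s + 1) = 1 := by
    rw [← pow_mul, (show Even ((n + 1) * (s + 1)) from by
      rw [Nat.even_mul]; exact Or.inr hs.add_one).neg_one_pow]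
  have h2 : (-1 : ℚ) ^ (3 * D * n + 1) = -1 := by
    rw [pow_succ, (show Even (3 * D * n) from by
      rw [mul_assoc]; exact hDn.mul_left 3).neg_one_pow]
    norm_num
  rw [R, R, hnum, hden, mul_pow, h1, h2]
  ring

/-- **Symmetry of the coefficients**: `a_{i,n-k} = (-1)^{i+1} a_{i,k}`, i.e. `c_{o,n-p} = (-1)^o c_{o,p}`,
from `R_n(-n-t) = -R_n(t)` and uniqueness of (2.1).
[cite: FischlerSprangZudilin2019, §2 proof of Lemma 1] -/
theorem IsPF.symm {s D n : ℕ} {c : ℕ → ℕ → ℚ} (hc : IsPF s D n c) (hs : Odd s) (hDn : Even (D * n))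
    (hD : 1 ≤ D) (o p : ℕ) (ho : o ≤ s) (hp : p ≤ n) : c o (n - p) = (-1) ^ o * c o p := by
  set e : ℕ → ℕ → ℚ := fun o p => (-1) ^ (o + 1) * c o (n - p) + c o p with he
  have hev : ∀ t : ℕ, 0 ≤ t → pfEval n (s + 1) e t = 0 := by
    intro t _
    have h1 : ∀ m, m ≤ n → (t : ℚ) + m + 1 ≠ 0 := fun m _ => by positivity
    have h2 : ∀ m, m ≤ n → (-(t : ℚ) - n - 2) + m + 1 ≠ 0 := by
      intro m hm h0
      have : (m : ℚ) ≤ n := by exact_mod_cast hm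
      have ht0 : (0 : ℚ) ≤ t := by positivity
      linarith
    have hadd : e = (fun o p => (-1) ^ (o + 1) * c o (n - p)) + c := by
      funext o p; simp [he]
    rw [hadd, pfEval_add, pfEval_reflect, hc _ h2, hc _ h1,
      show -(t : ℚ) - n - 2 + 1 = -(n : ℚ) - (t + 1) by ring, R_reflect s D n hs hDn hD]
    ring
  have h := pf_unique n (s + 1) e 0 hev o p (by omega) hp
  simp only [he] at h
  have hsq : ((-1 : ℚ) ^ (o + 1)) * ((-1 : ℚ) ^ (o + 1)) = 1 := by
    rw [← pow_add, ← two_mul, pow_mul]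
    norm_num
  calc c o (n - p) = (((-1 : ℚ) ^ (o + 1)) * ((-1 : ℚ) ^ (o + 1))) * c o (n - p) := by rw [hsq, one_mul]
    _ = (-1) ^ (o + 1) * (-(c o p)) := by rw [mul_assoc, eq_neg_of_add_eq_zero_left h]
    _ = (-1) ^ o * c o p := by ring

/-- **The even zeta values drop out**: `ρ_i = ∑_k a_{i,k} = 0` for even `i`, i.e. `∑_p c_{o,p} = 0` for odd
`o` ("This implies that `ρ_i = 0` when `i` is even").
[cite: FischlerSprangZudilin2019, §2 proof of Lemma 1] -/
theorem IsPF.sum_eq_zero_of_odd {s D n : ℕ} {c : ℕ → ℕ → ℚ} (hc : IsPF s D n c) (hs : Odd s)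
    (hDn : Even (D * n)) (hD : 1 ≤ D) (o : ℕ) (ho : o ≤ s) (hodd : Odd o) :
    ∑ p ∈ range (n + 1), c o p = 0 := by
  have hrefl : ∑ p ∈ range (n + 1), c o p = ∑ p ∈ range (n + 1), c o (n - p) := by
    conv_lhs => rw [← sum_range_reflect]
    refine sum_congr rfl fun p _ => ?_
    simp
  have hneg : ∑ p ∈ range (n + 1), c o (n - p) = -∑ p ∈ range (n + 1), c o p := by
    rw [← neg_one_mul, mul_sum]
    refine sum_congr rfl fun p hp => ?_
    rw [hc.symm hs hDn hD o p ho (Nat.lt_succ_iff.1 (mem_range.1 hp)), hodd.neg_one_pow]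
  linarith

/-! ### Decay of `R_n` at infinity and `∑_k a_{1,k} = 0` -/

/-- **Size of `R_n(u)` for large `u`**: `|R_n(u)| ≤ C/u²` for `u ≥ max(1, 2n)` (degree count: the
numerator has degree `3Dn+1`, the denominator `(n+1)(s+1) ≥ 3Dn + 3` when `s ≥ 3D`, `n, D ≥ 1`).
[folklore] -/
private theorem R_abs_le (s D n : ℕ) (h3D : 3 * D ≤ s) (hn : 1 ≤ n) (hD : 1 ≤ D) :
    ∃ C : ℚ, 0 ≤ C ∧ ∀ u : ℚ, 1 ≤ u → 2 * (n : ℚ) ≤ u → |R s D n u| ≤ C / u ^ 2 := by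
  refine ⟨(D : ℚ) ^ (3 * D * n) * (n.factorial : ℚ) ^ (s + 1 - 3 * D) * 2 ^ (3 * D * n + 1),
    by positivity, fun u hu1 hun => ?_⟩
  have hu0 : 0 < u := by linarith
  have hD0 : (0 : ℚ) < D := by exact_mod_cast hD
  -- numerator
  have hnum : |∏ j ∈ range (3 * D * n + 1), (u - n + (j : ℚ) / D)| ≤ (2 * u) ^ (3 * D * n + 1) := by
    rw [abs_prod, ← card_range (3 * D * n + 1), ← prod_const, card_range]
    refine prod_le_prod (fun j _ => abs_nonneg _) fun j hj => ?_
    have hj' : (j : ℚ) ≤ 3 * D * n := by exact_mod_cast (by have := mem_range.1 hj; omega)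
    have hjD : (j : ℚ) / D ≤ 3 * n := by
      rw [div_le_iff₀ hD0]
      nlinarith
    have hlo : 0 ≤ u - n + (j : ℚ) / D := by
      have : 0 ≤ (j : ℚ) / D := by positivity
      linarith
    rw [abs_of_nonneg hlo]
    linarith
  -- denominator
  have hden : u ^ (n + 1) ≤ ∏ j ∈ range (n + 1), (u + j) := by
    rw [← card_range (n + 1), ← prod_const, card_range]
    exact prod_le_prod (fun _ _ => hu0.le) fun j _ => by
      have : (0 : ℚ) ≤ j := by positivity
      linarith
  have hdenpos : 0 < ∏ j ∈ range (n + 1), (u + j) := prod_pos fun j _ => by positivity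
  obtain ⟨e, he⟩ : ∃ e : ℕ, (n + 1) * (s + 1) = (3 * D * n + 1) + 2 + e := by
    refine Nat.exists_eq_add_of_le ?_
    obtain ⟨k, rfl⟩ := Nat.exists_eq_add_of_le h3D
    nlinarith
  rw [R, abs_div, abs_mul, abs_mul, abs_pow, abs_pow, abs_of_nonneg hD0.le,
    abs_of_nonneg (by positivity : (0 : ℚ) ≤ n.factorial), abs_pow, abs_of_pos hdenpos,
    div_le_div_iff₀ (by positivity) (by positivity)]
  have hden' : u ^ ((n + 1) * (s + 1)) ≤ (∏ j ∈ range (n + 1), (u + j)) ^ (s + 1) := by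
    rw [pow_mul]
    exact pow_le_pow_left₀ (by positivity) hden _
  calc (D : ℚ) ^ (3 * D * n) * (n.factorial : ℚ) ^ (s + 1 - 3 * D) *
        |∏ j ∈ range (3 * D * n + 1), (u - n + (j : ℚ) / D)| * u ^ 2
      ≤ (D : ℚ) ^ (3 * D * n) * (n.factorial : ℚ) ^ (s + 1 - 3 * D) * (2 * u) ^ (3 * D * n + 1) * u ^ 2 := by
        gcongr
    _ = (D : ℚ) ^ (3 * D * n) * (n.factorial : ℚ) ^ (s + 1 - 3 * D) * 2 ^ (3 * D * n + 1) *
          (u ^ ((3 * D * n + 1) + 2) * 1) := by ring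
    _ ≤ (D : ℚ) ^ (3 * D * n) * (n.factorial : ℚ) ^ (s + 1 - 3 * D) * 2 ^ (3 * D * n + 1) *
          (u ^ ((3 * D * n + 1) + 2) * u ^ e) := by
        gcongr
        exact one_le_pow₀ hu1
    _ = (D : ℚ) ^ (3 * D * n) * (n.factorial : ℚ) ^ (s + 1 - 3 * D) * 2 ^ (3 * D * n + 1) *
          u ^ ((n + 1) * (s + 1)) := by rw [he, ← pow_add]
    _ ≤ _ := by gcongr

/-- **`∑_k a_{1,k} = lim_{t→∞} t R_n(t) = 0`** (the order of `R_n` at infinity is at least `2`).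
[cite: FischlerSprangZudilin2019, §2 proof of Lemma 1] -/
theorem IsPF.sum_zero_eq_zero {s D n : ℕ} {c : ℕ → ℕ → ℚ} (hc : IsPF s D n c) (h3D : 3 * D ≤ s)
    (hn : 1 ≤ n) (hD : 1 ≤ D) : ∑ p ∈ range (n + 1), c 0 p = 0 := by
  have hlim1 := tendsto_mul_pfEval n (s + 1) c
  have hval : ∑ p ∈ range (n + 1), ∑ o ∈ range (s + 1), (c o p : ℝ) * (0 : ℝ) ^ o =
      ((∑ p ∈ range (n + 1), c 0 p : ℚ) : ℝ) := by
    push_cast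
    refine sum_congr rfl fun p _ => ?_
    rw [sum_range_succ']
    simp
  rw [hval] at hlim1
  obtain ⟨C, hC0, hC⟩ := R_abs_le s D n h3D hn hD
  have hlim2 : Tendsto (fun k : ℕ => (k : ℝ) * (pfEval n (s + 1) c k : ℝ)) atTop (𝓝 0) := by
    have hb : ∀ k : ℕ, 2 * n ≤ k → |(k : ℝ) * (pfEval n (s + 1) c k : ℝ)| ≤ (C : ℝ) / ((k : ℝ) + 1) := by
      intro k hk
      have hk' : ∀ m, m ≤ n → (k : ℚ) + m + 1 ≠ 0 := fun m _ => by positivity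
      rw [hc k hk']
      have h1 : (1 : ℚ) ≤ k + 1 := by linarith [(Nat.cast_nonneg k : (0 : ℚ) ≤ k)]
      have h2 : 2 * (n : ℚ) ≤ k + 1 := by
        have : ((2 * n : ℕ) : ℚ) ≤ k := by exact_mod_cast hk
        push_cast at this; linarith
      have hR := hC ((k : ℚ) + 1) h1 h2
      have hR' : |(R s D n ((k : ℚ) + 1) : ℝ)| ≤ (C : ℝ) / ((k : ℝ) + 1) ^ 2 := by
        have := (Rat.cast_le (K := ℝ)).2 hR
        push_cast at this
        exact this
      rw [abs_mul, abs_of_nonneg (by positivity : (0 : ℝ) ≤ k)]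
      have hk0 : (0 : ℝ) ≤ k := by positivity
      calc (k : ℝ) * |(R s D n ((k : ℚ) + 1) : ℝ)| ≤ (k : ℝ) * ((C : ℝ) / ((k : ℝ) + 1) ^ 2) := by gcongr
        _ ≤ ((k : ℝ) + 1) * ((C : ℝ) / ((k : ℝ) + 1) ^ 2) := by gcongr; linarith
        _ = (C : ℝ) / ((k : ℝ) + 1) := by field_simp
    have hC' : Tendsto (fun k : ℕ => (C : ℝ) / ((k : ℝ) + 1)) atTop (𝓝 0) := by
      have h := (tendsto_one_div_add_atTop_nhds_zero_nat (𝕜 := ℝ)).const_mul (C : ℝ)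
      rw [mul_zero] at h
      refine h.congr fun k => ?_
      rw [mul_one_div]
    refine squeeze_zero_norm' ?_ hC'
    exact eventually_atTop.2 ⟨2 * n, fun k hk => by rw [Real.norm_eq_abs]; exact hb k hk⟩
  have := tendsto_nhds_unique hlim1 hlim2
  exact_mod_cast this

/-! ### §2: the linear forms `r_{n,j}`, `ρ_i`, `ρ_{0,j}` and Lemma 1 -/

/-- **`ρ_i = ∑_{k=0}^{n} a_{i,k}`** (`i ≥ 1`; in `pfEval` coordinates `a_{i,k} = c (i-1) k`).
[cite: FischlerSprangZudilin2019, §2 Lemma 1 (definition of ρ_i)] -/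
def rho (n : ℕ) (c : ℕ → ℕ → ℚ) (i : ℕ) : ℚ := ∑ k ∈ range (n + 1), c (i - 1) k

/-- **`ρ_{0,j} = -∑_{k=0}^{n} ∑_{ℓ=0}^{k} ∑_{i=1}^{s+1} a_{i,k}/(ℓ + j/D)^i`** (eq. (2.2) of the source, written
with `i = o + 1`, `a_{i,k} = c o k`; the source's upper limit is `i = s`, the extra `i = s+1` terms vanish, see
`IsPF`). [cite: FischlerSprangZudilin2019, §2 Lemma 1 eq. (2.2)] -/
def rhoZero (s D n : ℕ) (c : ℕ → ℕ → ℚ) (j : ℕ) : ℚ :=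
  -∑ k ∈ range (n + 1), ∑ ℓ ∈ range (k + 1), ∑ o ∈ range (s + 1),
    c o k / ((ℓ : ℚ) + (j : ℚ) / D) ^ (o + 1)

/-- **`r_{n,j} = ∑_{m=1}^{∞} R_n(m + j/D)`** (`j ∈ {1, …, D}`), a real number.
[cite: FischlerSprangZudilin2019, §2 (definition of r_{n,j})] -/
def r (s D n j : ℕ) : ℝ := ∑' m : ℕ, (R s D n ((m : ℚ) + 1 + (j : ℚ) / D) : ℝ)

/-- Summability of the Hurwitz series `∑_{n ≥ 0} (n+a)^{-i}` for `i ≥ 2`, `a > 0`. [folklore] -/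
private theorem summable_one_div_nat_add_pow {a : ℝ} (ha : 0 < a) {i : ℕ} (hi : 2 ≤ i) :
    Summable (fun n : ℕ => 1 / ((n : ℝ) + a) ^ i) := by
  have h := (Real.summable_one_div_nat_add_rpow a i).2 (by exact_mod_cast hi)
  refine h.congr fun n => ?_
  rw [abs_of_pos (by positivity), Real.rpow_natCast]

/-- `∑_{m ≥ 0} (m + p + 1 + a)^{-i} = ζ(i, a) - ∑_{ℓ ≤ p} (ℓ + a)^{-i}` for `i ≥ 2`, `a > 0`, with the tree's
real Hurwitz value `hurwitzValue i a = ∑_{n ≥ 0} (n+a)^{-i}`. [folklore] -/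
private theorem hasSum_one_div_pow_hurwitz_shift {a : ℝ} (ha : 0 < a) {i : ℕ} (hi : 2 ≤ i) (p : ℕ) :
    HasSum (fun m : ℕ => 1 / ((m : ℝ) + p + 1 + a) ^ i)
      (hurwitzValue i a - ∑ ℓ ∈ range (p + 1), 1 / ((ℓ : ℝ) + a) ^ i) := by
  have hs := summable_one_div_nat_add_pow ha hi
  have h := (hasSum_nat_add_iff' (f := fun n : ℕ => 1 / ((n : ℝ) + a) ^ i) (p + 1)).2 hs.hasSum
  rw [hurwitzValue]
  refine h.congr_fun fun m => ?_
  push_cast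
  ring_nf

/-- The telescoping sum `∑_{m ≥ 0} (1/(m+b) - 1/(m+b+p)) = ∑_{ℓ < p} 1/(ℓ+b)` (`b > 0`). [folklore] -/
private theorem hasSum_telescope_shift {b : ℝ} (hb : 0 < b) (p : ℕ) :
    HasSum (fun m : ℕ => 1 / ((m : ℝ) + b) - 1 / ((m : ℝ) + b + p)) (∑ ℓ ∈ range p, 1 / ((ℓ : ℝ) + b)) := by
  set g : ℕ → ℝ := fun m => 1 / ((m : ℝ) + b) with hg
  have hnn : ∀ m : ℕ, 0 ≤ 1 / ((m : ℝ) + b) - 1 / ((m : ℝ) + b + p) := by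
    intro m
    rw [sub_nonneg]
    exact one_div_le_one_div_of_le (by positivity) (by
      have : (0 : ℝ) ≤ p := by positivity
      linarith)
  rw [hasSum_iff_tendsto_nat_of_nonneg hnn]
  have hpart : ∀ M : ℕ, ∑ m ∈ range M, (1 / ((m : ℝ) + b) - 1 / ((m : ℝ) + b + p)) =
      ∑ ℓ ∈ range p, g ℓ - ∑ ℓ ∈ range p, g (M + ℓ) := by
    intro M
    have h1 := sum_range_add g M p
    have h2 := sum_range_add g p M
    rw [add_comm p M] at h2
    have h3 : ∑ m ∈ range M, (1 / ((m : ℝ) + b) - 1 / ((m : ℝ) + b + p)) =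
        ∑ m ∈ range M, g m - ∑ m ∈ range M, g (p + m) := by
      rw [← sum_sub_distrib]
      refine sum_congr rfl fun m _ => ?_
      simp only [hg]
      push_cast
      ring_nf
    rw [h3]
    linarith
  simp_rw [hpart]
  have hlim : Tendsto (fun M : ℕ => ∑ ℓ ∈ range p, g (M + ℓ)) atTop (𝓝 0) := by
    rw [show (0 : ℝ) = ∑ ℓ ∈ range p, (0 : ℝ) by simp]
    refine tendsto_finsetSum _ fun ℓ _ => ?_
    have h1 : Tendsto (fun M : ℕ => (M : ℝ) + ℓ + b) atTop atTop :=
      tendsto_atTop_add_const_right _ _ (tendsto_atTop_add_const_right _ _ tendsto_natCast_atTop_atTop)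
    have hb' : Tendsto (fun M : ℕ => 1 / ((M : ℝ) + ℓ + b)) atTop (𝓝 0) := by
      simp_rw [one_div]
      exact tendsto_inv_atTop_zero.comp h1
    refine hb'.congr fun M => ?_
    simp only [hg]
    push_cast
    ring_nf
  have := (tendsto_const_nhds (x := ∑ ℓ ∈ range p, g ℓ)).sub hlim
  rw [sub_zero] at this
  exact this

/-- The partial-fraction expansion at the shifted arguments, over `ℝ`: for `t'` off the poles,
`R_n(t'+1) = ∑_p ∑_o c_{o,p}/(t'+p+1)^{o+1}`. [folklore] -/
private theorem IsPF.cast_eval {s D n : ℕ} {c : ℕ → ℕ → ℚ} (hc : IsPF s D n c) (t : ℚ)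
    (ht : ∀ m, m ≤ n → t + m + 1 ≠ 0) :
    (R s D n (t + 1) : ℝ) = ∑ p ∈ range (n + 1), ∑ o ∈ range (s + 1),
      (c o p : ℝ) / ((t : ℝ) + p + 1) ^ (o + 1) := by
  rw [← hc t ht, pfEval]
  push_cast
  rfl

/-- **Lemma 1 of Fischler–Sprang–Zudilin 2019** (= [Sprang 2018, Lemma 1]; PROVED): for `s` odd, `s ≥ 3D`,
`n ≥ 1` with `Dn` even, any partial-fraction data `c` of `R_n` (`IsPF`) and `j ∈ {1, …, D}`,
`r_{n,j} = ∑_{m ≥ 1} R_n(m + j/D) = ρ_{0,j} + ∑_{3 ≤ i ≤ s, i odd} ρ_i ζ(i, j/D)`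
with `ρ_i = ∑_k a_{i,k}` independent of `j`, `ρ_{0,j}` as in (2.2), and `ζ(i, α) = ∑_{ν ≥ 0} (ν + α)^{-i}` the
Hurwitz zeta value (tree: `DirichletLValues.hurwitzValue`). Stated as a `HasSum` over `m ≥ 0` of
`R_n(m + 1 + j/D)`. The proof is the source's: the expansion (2.1) summed against the Hurwitz series,
`∑_k a_{1,k} = 0` for the order-one terms (the source passes through the Lerch function and `z → 1`; here the
order-one terms are telescoped directly), and `ρ_i = 0` for even `i` by the reflection symmetry.
[cite: FischlerSprangZudilin2019, §2 Lemma 1] -/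
theorem lemma1 {s D n : ℕ} (hs : Odd s) (h3D : 3 * D ≤ s) (hn : 1 ≤ n) (hDn : Even (D * n))
    {c : ℕ → ℕ → ℚ} (hc : IsPF s D n c) (j : ℕ) (hj : 1 ≤ j) (hjD : j ≤ D) :
    HasSum (fun m : ℕ => (R s D n ((m : ℚ) + 1 + (j : ℚ) / D) : ℝ))
      ((rhoZero s D n c j : ℝ) +
        ∑ i ∈ (Icc 3 s).filter Odd, (rho n c i : ℝ) * hurwitzValue i ((j : ℝ) / D)) := by
  have hD : 1 ≤ D := hj.trans hjD
  set α : ℝ := (j : ℝ) / D with hα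
  have hα0 : 0 < α := by rw [hα]; positivity
  have hz : ∑ p ∈ range (n + 1), c 0 p = 0 := hc.sum_zero_eq_zero h3D hn hD
  have hzR : ∑ p ∈ range (n + 1), (c 0 p : ℝ) = 0 := by exact_mod_cast hz
  -- Step 1: the summand, expanded and with the order-one terms telescoped
  have hterm : ∀ m : ℕ, (R s D n ((m : ℚ) + 1 + (j : ℚ) / D) : ℝ) =
      ∑ p ∈ range (n + 1), (∑ o ∈ range s,
          (c (o + 1) p : ℝ) * (1 / ((m : ℝ) + p + 1 + α) ^ (o + 2)) +
        -(c 0 p : ℝ) * (1 / ((m : ℝ) + (1 + α)) - 1 / ((m : ℝ) + (1 + α) + p))) := by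
    intro m
    have ht : ∀ m', m' ≤ n → ((m : ℚ) + (j : ℚ) / D) + m' + 1 ≠ 0 := fun m' _ => by positivity
    have h := hc.cast_eval ((m : ℚ) + (j : ℚ) / D) ht
    rw [show (m : ℚ) + (j : ℚ) / D + 1 = (m : ℚ) + 1 + (j : ℚ) / D by ring] at h
    rw [h]
    have h0 : ∑ p ∈ range (n + 1), (c 0 p : ℝ) * (1 / ((m : ℝ) + (1 + α))) = 0 := by
      rw [← sum_mul, hzR, zero_mul]
    rw [← sub_zero (∑ p ∈ range (n + 1), ∑ o ∈ range (s + 1), _), ← h0, ← sum_sub_distrib]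
    refine sum_congr rfl fun p _ => ?_
    rw [sum_range_succ']
    push_cast
    rw [hα]
    ring_nf
  simp_rw [hterm]
  -- Step 2: sum over `m`, term by term
  have hsum : HasSum (fun m : ℕ => ∑ p ∈ range (n + 1), (∑ o ∈ range s,
          (c (o + 1) p : ℝ) * (1 / ((m : ℝ) + p + 1 + α) ^ (o + 2)) +
        -(c 0 p : ℝ) * (1 / ((m : ℝ) + (1 + α)) - 1 / ((m : ℝ) + (1 + α) + p))))
      (∑ p ∈ range (n + 1), (∑ o ∈ range s,
          (c (o + 1) p : ℝ) * (hurwitzValue (o + 2) α - ∑ ℓ ∈ range (p + 1), 1 / ((ℓ : ℝ) + α) ^ (o + 2)) +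
        -(c 0 p : ℝ) * ∑ ℓ ∈ range p, 1 / ((ℓ : ℝ) + (1 + α)))) := by
    refine hasSum_sum fun p _ => HasSum.add (hasSum_sum fun o _ => ?_) ?_
    · exact (hasSum_one_div_pow_hurwitz_shift hα0 (by omega) p).mul_left _
    · exact (hasSum_telescope_shift (by positivity : (0 : ℝ) < 1 + α) p).mul_left _
  convert hsum using 1
  -- Step 3: identification of the value
  have hrho0 : (rhoZero s D n c j : ℝ) =
      -∑ p ∈ range (n + 1), ((∑ o ∈ range s,
          (c (o + 1) p : ℝ) * ∑ ℓ ∈ range (p + 1), 1 / ((ℓ : ℝ) + α) ^ (o + 2)) +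
        (c 0 p : ℝ) * ∑ ℓ ∈ range p, 1 / ((ℓ : ℝ) + (1 + α))) := by
    have h0 : ∑ p ∈ range (n + 1), (c 0 p : ℝ) * (1 / α) = 0 := by
      rw [← sum_mul, hzR, zero_mul]
    rw [rhoZero]
    push_cast
    rw [← hα, neg_inj, ← add_zero (∑ p ∈ range (n + 1), (_ + _)), ← h0, ← sum_add_distrib]
    refine sum_congr rfl fun p _ => ?_
    rw [sum_comm, sum_range_succ', sum_range_succ' (fun ℓ => (c 0 p : ℝ) / ((ℓ : ℝ) + α) ^ (0 + 1))]
    simp only [mul_sum]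
    have e1 : ∀ o ∈ range s, ∑ ℓ ∈ range (p + 1), (c (o + 1) p : ℝ) / ((ℓ : ℝ) + α) ^ (o + 1 + 1) =
        ∑ ℓ ∈ range (p + 1), (c (o + 1) p : ℝ) * (1 / ((ℓ : ℝ) + α) ^ (o + 2)) :=
      fun o _ => sum_congr rfl fun ℓ _ => by ring
    have e2 : ∑ ℓ ∈ range p, (c 0 p : ℝ) / (((ℓ + 1 : ℕ) : ℝ) + α) ^ (0 + 1) =
        ∑ ℓ ∈ range p, (c 0 p : ℝ) * (1 / ((ℓ : ℝ) + (1 + α))) :=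
      sum_congr rfl fun ℓ _ => by push_cast; ring
    rw [sum_congr rfl e1, e2]
    push_cast
    ring
  have hzeta : ∑ i ∈ (Icc 3 s).filter Odd, (rho n c i : ℝ) * hurwitzValue i α =
      ∑ p ∈ range (n + 1), ∑ o ∈ range s, (c (o + 1) p : ℝ) * hurwitzValue (o + 2) α := by
    rw [sum_comm]
    have h1 : ∑ o ∈ range s, ∑ p ∈ range (n + 1), (c (o + 1) p : ℝ) * hurwitzValue (o + 2) α =
        ∑ i ∈ Ico 2 (s + 2), (rho n c i : ℝ) * hurwitzValue i α := by
      rw [sum_Ico_eq_sum_range, show s + 2 - 2 = s by omega]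
      refine sum_congr rfl fun o _ => ?_
      rw [rho, show 2 + o - 1 = o + 1 by omega, add_comm 2 o]
      push_cast
      rw [sum_mul]
    rw [h1]
    have h2 : (Icc 3 s).filter Odd = (Ico 2 (s + 2)).filter Odd := by
      ext i
      simp only [mem_filter, mem_Icc, mem_Ico]
      constructor
      · rintro ⟨⟨h3, h4⟩, ho⟩; exact ⟨⟨by omega, by omega⟩, ho⟩
      · rintro ⟨⟨h3, h4⟩, ho⟩
        have h5 := Nat.odd_iff.1 ho
        have h6 := Nat.odd_iff.1 hs
        refine ⟨⟨by omega, by omega⟩, ho⟩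
    rw [h2, sum_filter_of_ne]
    intro i hi hne
    by_contra hodd
    apply hne
    have hev : Odd (i - 1) := by
      have h5 := (mem_Ico.1 hi).1
      rcases Nat.even_or_odd i with h | h
      · have := Nat.even_iff.1 h
        exact Nat.odd_iff.2 (by omega)
      · exact absurd h hodd
    rw [rho, show ∑ k ∈ range (n + 1), c (i - 1) k = 0 from
      hc.sum_eq_zero_of_odd hs hDn hD (i - 1) (by have := (mem_Ico.1 hi).2; omega) hev]
    simp
  rw [hrho0, hzeta, neg_add_eq_sub, ← sum_sub_distrib]
  refine sum_congr rfl fun p _ => ?_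
  simp only [mul_sub, sum_sub_distrib]
  ring

/-- **`r_{n,j}` identified** (Lemma 1 in `tsum` form): `r_{n,j} = ρ_{0,j} + ∑_{3 ≤ i ≤ s odd} ρ_i ζ(i, j/D)`.
[cite: FischlerSprangZudilin2019, §2 Lemma 1] -/
theorem r_eq {s D n : ℕ} (hs : Odd s) (h3D : 3 * D ≤ s) (hn : 1 ≤ n) (hDn : Even (D * n))
    {c : ℕ → ℕ → ℚ} (hc : IsPF s D n c) (j : ℕ) (hj : 1 ≤ j) (hjD : j ≤ D) :
    r s D n j = (rhoZero s D n c j : ℝ) +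
      ∑ i ∈ (Icc 3 s).filter Odd, (rho n c i : ℝ) * hurwitzValue i ((j : ℝ) / D) :=
  (lemma1 hs h3D hn hDn hc j hj hjD).tsum_eq

/-- **`ρ_i = 0` for even `i`** (`2 ≤ i ≤ s + 1`). [cite: FischlerSprangZudilin2019, §2 proof of Lemma 1] -/
theorem rho_eq_zero_of_even {s D n : ℕ} {c : ℕ → ℕ → ℚ} (hc : IsPF s D n c) (hs : Odd s)
    (hDn : Even (D * n)) (hD : 1 ≤ D) (i : ℕ) (hi2 : 2 ≤ i) (hi : i ≤ s + 1) (hev : Even i) :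
    rho n c i = 0 := by
  rw [rho]
  refine hc.sum_eq_zero_of_odd hs hDn hD (i - 1) (by omega) ?_
  have h := Nat.even_iff.1 hev
  exact Nat.odd_iff.2 (by omega)

/-! ### §3, Lemma 2 -/

/-- **Lemma 2, (3.1)** (PROVED): `d^{s+1-i} ρ_i ∈ ℤ` for every `1 ≤ i ≤ s+1` and every common multiple `d`
of `1, …, n` — in particular `d_n^{s+1-i} ρ_i ∈ ℤ` for `i = 3, 5, …, s` as printed (`d_n = lcm(1, …, n)`).
[cite: FischlerSprangZudilin2019, §3 Lemma 2 eq. (3.1)] -/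
theorem lemma2_rho {s D n : ℕ} {c : ℕ → ℕ → ℚ} (hc : IsPF s D n c) (h3D : 3 * D ≤ s) (hn : 1 ≤ n)
    (hD : 1 ≤ D) (d : ℕ) (hdiv : ∀ k : ℕ, 1 ≤ k → k ≤ n → (k : ℤ) ∣ d) (i : ℕ) (hi1 : 1 ≤ i)
    (hi : i ≤ s + 1) : ∃ z : ℤ, (d : ℚ) ^ (s + 1 - i) * rho n c i = z := by
  have h : ∀ k ∈ range (n + 1), ∃ z : ℤ, (d : ℚ) ^ (s + 1 - i) * c (i - 1) k = z := by
    intro k hk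
    obtain ⟨z, hz⟩ := hc.isInt_coeff h3D hn hD d hdiv (i - 1) k (by omega)
      (Nat.lt_succ_iff.1 (mem_range.1 hk))
    exact ⟨z, by rw [← hz, show s - (i - 1) = s + 1 - i by omega]⟩
  choose! z hz using h
  refine ⟨∑ k ∈ range (n + 1), z k, ?_⟩
  rw [rho, mul_sum]
  push_cast
  exact sum_congr rfl hz

/-! #### `p`-integral rationals (bookkeeping for the proof of (3.2)) -/

/-- `x ∈ ℚ` is `p`-integral: `p` does not divide the (reduced) denominator of `x`. [folklore] -/
private def PIntegral (p : ℕ) (x : ℚ) : Prop := ¬ p ∣ x.den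

namespace PIntegral

variable {p : ℕ}

/-- Integers are `p`-integral. [folklore] -/
private theorem intCast (hp : p.Prime) (z : ℤ) : PIntegral p (z : ℚ) := by
  rw [PIntegral, Rat.den_intCast]
  exact hp.not_dvd_one

/-- Closure under addition. [folklore] -/
private theorem add (hp : p.Prime) {x y : ℚ} (hx : PIntegral p x) (hy : PIntegral p y) : PIntegral p (x + y) := by
  intro h
  rcases (Nat.Prime.dvd_mul hp).1 (h.trans (Rat.add_den_dvd x y)) with h1 | h1
  · exact hx h1
  · exact hy h1

/-- Closure under multiplication. [folklore] -/
private theorem mul (hp : p.Prime) {x y : ℚ} (hx : PIntegral p x) (hy : PIntegral p y) : PIntegral p (x * y) := by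
  intro h
  rcases (Nat.Prime.dvd_mul hp).1 (h.trans (Rat.mul_den_dvd x y)) with h1 | h1
  · exact hx h1
  · exact hy h1

/-- Closure under negation. [folklore] -/
private theorem neg {x : ℚ} (hx : PIntegral p x) : PIntegral p (-x) := by
  rw [PIntegral, Rat.neg_den]; exact hx

/-- Closure under powers. [folklore] -/
private theorem pow (hp : p.Prime) {x : ℚ} (hx : PIntegral p x) (k : ℕ) : PIntegral p (x ^ k) := by
  induction k with
  | zero => rw [pow_zero]; exact_mod_cast intCast hp 1
  | succ k ih => rw [pow_succ]; exact ih.mul hp hx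

/-- Closure under finite sums. [folklore] -/
private theorem sum (hp : p.Prime) {ι : Type*} (S : Finset ι) {f : ι → ℚ} (hf : ∀ i ∈ S, PIntegral p (f i)) :
    PIntegral p (∑ i ∈ S, f i) := by
  classical
  induction S using Finset.induction_on with
  | empty => rw [sum_empty]; exact_mod_cast intCast hp 0
  | insert a S ha ih =>
    rw [sum_insert ha]
    exact (hf a (mem_insert_self a S)).add hp (ih fun i hi => hf i (mem_insert_of_mem hi))

/-- A rational that is `p`-integral for every prime `p` is an integer. [folklore] -/
private theorem exists_int_of_forall {x : ℚ} (h : ∀ p : ℕ, p.Prime → PIntegral p x) : ∃ z : ℤ, x = z := by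
  by_cases hd : x.den = 1
  · exact ⟨x.num, (Rat.coe_int_num_of_den_eq_one hd).symm⟩
  · obtain ⟨p, hp, hpd⟩ := Nat.exists_prime_and_dvd hd
    exact absurd hpd (h p hp)

/-- **The valuation criterion**: `a/b` (`a ∈ ℕ`, `b ∈ ℤ ∖ {0}`) is `p`-integral as soon as `p^{w+1} ∤ b`,
where `w = v_p(a)` (i.e. `v_p(b) ≤ v_p(a)`; for `a = 0` the hypothesis reads `p ∤ b`). [folklore] -/
private theorem div_of_not_pow_dvd (hp : p.Prime) (a : ℕ) (b : ℤ) (hb : b ≠ 0)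
    (h : ¬ (p : ℤ) ^ (a.factorization p + 1) ∣ b) : PIntegral p ((a : ℚ) / b) := by
  -- reduce to `b > 0`
  wlog hbpos : 0 < b generalizing b
  · have hb' : 0 < -b := by omega
    have h' : ¬ (p : ℤ) ^ (a.factorization p + 1) ∣ -b := fun hd => h (dvd_neg.1 hd)
    have := this (-b) (by omega) h' hb'
    rw [Int.cast_neg, div_neg] at this
    simpa [PIntegral, Rat.neg_den] using this
  obtain ⟨B, rfl⟩ := Int.eq_ofNat_of_zero_le hbpos.le
  have hB : B ≠ 0 := by omega
  set e := B.factorization p with he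
  have hew : e ≤ a.factorization p := by
    by_contra hlt
    apply h
    have h1 : p ^ (a.factorization p + 1) ∣ B :=
      (pow_dvd_pow p (by omega)).trans (Nat.ordProj_dvd B p)
    exact_mod_cast h1
  obtain ⟨a', ha'⟩ : p ^ e ∣ a := (pow_dvd_pow p hew).trans (Nat.ordProj_dvd a p)
  have hBsplit : p ^ e * (B / p ^ e) = B := Nat.ordProj_mul_ordCompl_eq_self B p
  set B' := B / p ^ e with hB'
  have hcop : Nat.Coprime p B' := Nat.coprime_ordCompl hp hB
  have hpe : (p : ℚ) ^ e ≠ 0 := pow_ne_zero _ (by exact_mod_cast hp.ne_zero)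
  have hB'0 : (B' : ℚ) ≠ 0 := by
    have : B' ≠ 0 := fun h0 => by rw [h0, mul_zero] at hBsplit; exact hB hBsplit.symm
    exact_mod_cast this
  have hx : ((a : ℚ) / ((B : ℕ) : ℤ)) = ((a' : ℤ) : ℚ) / (B' : ℕ) := by
    rw [ha', ← hBsplit]
    push_cast
    field_simp
  rw [PIntegral, hx]
  intro hd
  have hden : (((a' : ℤ) : ℚ) / (B' : ℕ)).den ∣ B' := by
    have h := Rat.den_dvd a' B'
    rw [Rat.divInt_eq_div] at h
    push_cast at h
    exact_mod_cast h
  have := Nat.Coprime.eq_one_of_dvd (hcop.coprime_dvd_right hden) (by simpa using hd)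
  exact hp.one_lt.ne' this

end PIntegral

/-! #### Proof of (3.2) -/

/-- The inner sums of (3.4)/(3.5): `E_{k'}(m) = ∑_{i=1}^{s+1} d^{s+1} a_{i,k'}/(m + j/D)^i` (`m ∈ ℤ`).
[cite: FischlerSprangZudilin2019, §3 proof of Lemma 2, eq. (3.4)] -/
def innerSum (s D d : ℕ) (c : ℕ → ℕ → ℚ) (j k' : ℕ) (m : ℤ) : ℚ :=
  ∑ o ∈ range (s + 1), (d : ℚ) ^ (s + 1) * c o k' / ((m : ℚ) + (j : ℚ) / D) ^ (o + 1)

/-- Eq. (3.4): `d^{s+1} ρ_{0,j} = -∑_{k ≤ n} ∑_{ℓ ≤ k} E_k(ℓ)`. [cite: FischlerSprangZudilin2019, §3 eq. (3.4)] -/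
theorem pow_mul_rhoZero_eq (s D n d : ℕ) (c : ℕ → ℕ → ℚ) (j : ℕ) :
    (d : ℚ) ^ (s + 1) * rhoZero s D n c j =
      -∑ k ∈ range (n + 1), ∑ ℓ ∈ range (k + 1), innerSum s D d c j k (ℓ : ℤ) := by
  rw [rhoZero, mul_neg, mul_sum]
  congr 1
  refine sum_congr rfl fun k _ => ?_
  rw [mul_sum]
  refine sum_congr rfl fun ℓ _ => ?_
  rw [innerSum, mul_sum]
  refine sum_congr rfl fun o _ => ?_
  push_cast
  ring

/-- `j/D` is not an integer for `1 ≤ j < D`: `m + j/D ≠ 0` for every integer `m`. [folklore] -/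
private theorem intCast_add_div_ne_zero {D j : ℕ} (hj : 1 ≤ j) (hjD : j < D) (m : ℤ) :
    (m : ℚ) + (j : ℚ) / D ≠ 0 := by
  intro h
  have hD0 : (D : ℚ) ≠ 0 := by exact_mod_cast (by omega : D ≠ 0)
  have h1 : (j : ℚ) = D * (-m) := by field_simp at h; linarith
  have h2 : (j : ℤ) = D * (-m) := by exact_mod_cast h1
  have h3 : (D : ℤ) ∣ j := ⟨-m, h2⟩
  have h4 := Int.le_of_dvd (by exact_mod_cast hj) h3
  omega

/-- **Eq. (3.5)**: for `1 ≤ j < D` and `0 ≤ ℓ ≤ k ≤ n`, `R_n(ℓ - k + j/D) = 0` (a zero of the numerator), whence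
`∑_{k' ≤ n} E_{k'}(ℓ - k + k') = 0`. [cite: FischlerSprangZudilin2019, §3 proof of Lemma 2, eq. (3.5)] -/
theorem sum_innerSum_window_eq_zero {s D n : ℕ} {c : ℕ → ℕ → ℚ} (hc : IsPF s D n c) (hn : 1 ≤ n)
    (d : ℕ) {j : ℕ} (hj : 1 ≤ j) (hjD : j < D) {k ℓ : ℕ} (hℓk : ℓ ≤ k) (hkn : k ≤ n) :
    ∑ k' ∈ range (n + 1), innerSum s D d c j k' ((ℓ : ℤ) - k + k') = 0 := by
  have hD0 : (D : ℚ) ≠ 0 := by exact_mod_cast (by omega : D ≠ 0)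
  set t : ℚ := (ℓ : ℚ) - k + (j : ℚ) / D - 1 with ht
  have ht' : ∀ m, m ≤ n → t + m + 1 ≠ 0 := by
    intro m _ h0
    apply intCast_add_div_ne_zero hj hjD ((ℓ : ℤ) - k + m)
    push_cast
    rw [ht] at h0
    linarith
  have hR : R s D n (t + 1) = 0 := by
    rw [R]
    have hzero : ∏ j' ∈ range (3 * D * n + 1), (t + 1 - n + (j' : ℚ) / D) = 0 := by
      refine prod_eq_zero (i := D * (n + k - ℓ) - j) (mem_range.2 ?_) ?_
      · have h1 : D * (n + k - ℓ) ≤ D * (2 * n) := Nat.mul_le_mul_left _ (by omega)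
        have h2 : D * (2 * n) ≤ 3 * D * n := by nlinarith
        generalize D * (n + k - ℓ) = A at *
        generalize 3 * D * n = B at *
        omega
      · have h1 : j ≤ D * (n + k - ℓ) := (le_of_lt hjD).trans (Nat.le_mul_of_pos_right _ (by omega))
        rw [Nat.cast_sub h1, Nat.cast_mul, Nat.cast_sub (by omega : ℓ ≤ n + k), ht]
        push_cast
        field_simp
        ring
    rw [hzero, mul_zero, zero_div]
  have h := hc t ht'
  rw [hR, pfEval] at h
  have h2 : ∑ k' ∈ range (n + 1), innerSum s D d c j k' ((ℓ : ℤ) - k + k') =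
      (d : ℚ) ^ (s + 1) * ∑ p ∈ range (n + 1), ∑ o ∈ range (s + 1), c o p / (t + p + 1) ^ (o + 1) := by
    rw [mul_sum]
    refine sum_congr rfl fun k' _ => ?_
    rw [innerSum, mul_sum]
    refine sum_congr rfl fun o _ => ?_
    rw [ht]
    push_cast
    ring_nf
  rw [h2, h, mul_zero]

/-- For `m ∈ ℤ` with `p^{v_p(dD)+1} ∤ Dm + j` ("good" `m`), `E_{k'}(m)` is `p`-integral: each term is
`(d^{s+1-i} a_{i,k'}) · (dD/(Dm+j))^i`. [cite: FischlerSprangZudilin2019, §3 proof of Lemma 2] -/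
private theorem pIntegral_innerSum {s D n : ℕ} {c : ℕ → ℕ → ℚ} (hc : IsPF s D n c) (h3D : 3 * D ≤ s)
    (hn : 1 ≤ n) {d : ℕ} (hdiv : ∀ k : ℕ, 1 ≤ k → k ≤ n → (k : ℤ) ∣ d) {j : ℕ} (hj : 1 ≤ j)
    (hjD : j < D) {p : ℕ} (hp : p.Prime) (k' : ℕ) (hk' : k' ≤ n) (m : ℤ)
    (hgood : ¬ (p : ℤ) ^ ((d * D).factorization p + 1) ∣ (D : ℤ) * m + j) :
    PIntegral p (innerSum s D d c j k' m) := by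
  have hD : 1 ≤ D := by omega
  have hD0 : (D : ℚ) ≠ 0 := by exact_mod_cast (by omega : D ≠ 0)
  have hmj : (m : ℚ) + (j : ℚ) / D = ((D : ℚ) * m + j) / D := by field_simp
  have hb : (D : ℤ) * m + j ≠ 0 := by
    intro h0
    apply intCast_add_div_ne_zero hj hjD m
    have h1 : (D : ℚ) * m + j = 0 := by exact_mod_cast h0
    rw [hmj, h1, zero_div]
  have hbq : (D : ℚ) * m + j ≠ 0 := by exact_mod_cast hb
  rw [innerSum]
  refine PIntegral.sum hp _ fun o ho => ?_
  have ho' : o ≤ s := Nat.lt_succ_iff.1 (mem_range.1 ho)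
  obtain ⟨z, hz⟩ := hc.isInt_coeff h3D hn hD d hdiv o k' ho' hk'
  have hq := PIntegral.div_of_not_pow_dvd hp (d * D) ((D : ℤ) * m + j) hb hgood
  have hterm : (d : ℚ) ^ (s + 1) * c o k' / ((m : ℚ) + (j : ℚ) / D) ^ (o + 1) =
      (z : ℚ) * (((d * D : ℕ) : ℚ) / (((D : ℤ) * m + j : ℤ) : ℚ)) ^ (o + 1) := by
    rw [← hz, show s + 1 = (s - o) + (o + 1) by omega, pow_add, hmj]
    push_cast
    rw [div_pow, div_pow]
    field_simp
    ring
  rw [hterm]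
  exact (PIntegral.intCast hp z).mul hp (hq.pow hp _)

/-- **At most one "bad" `m` in a window of length `n`**: if `p^{v_p(dD)+1}` divides both `Dm₁ + j` and
`Dm₂ + j` with `0 < |m₁ - m₂| ≤ n` and `d` a common multiple of `1, …, n`, contradiction
("`v_p(k₀ - k₁) > v_p(d_{n+1})`, which is impossible"). [cite: FischlerSprangZudilin2019, §3 proof of Lemma 2] -/
theorem not_two_bad {D n d j p : ℕ} (hp : p.Prime) (hd : d ≠ 0) (hD : D ≠ 0)
    (hdiv : ∀ k : ℕ, 1 ≤ k → k ≤ n → (k : ℤ) ∣ d) {m₁ m₂ : ℤ} (hne : m₁ ≠ m₂)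
    (hdist : (m₁ - m₂).natAbs ≤ n)
    (h₁ : (p : ℤ) ^ ((d * D).factorization p + 1) ∣ (D : ℤ) * m₁ + j)
    (h₂ : (p : ℤ) ^ ((d * D).factorization p + 1) ∣ (D : ℤ) * m₂ + j) : False := by
  set w := (d * D).factorization p with hw
  have h3 : (p : ℤ) ^ (w + 1) ∣ (D : ℤ) * (m₁ - m₂) := by
    have := dvd_sub h₁ h₂
    rw [show (D : ℤ) * m₁ + j - ((D : ℤ) * m₂ + j) = (D : ℤ) * (m₁ - m₂) by ring] at this
    exact this
  have h4 : (m₁ - m₂) ∣ (d : ℤ) := by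
    have h5 : (((m₁ - m₂).natAbs : ℕ) : ℤ) ∣ d :=
      hdiv _ (Int.natAbs_pos.2 (sub_ne_zero.2 hne)) hdist
    exact Int.natAbs_dvd.1 h5
  have h6 : (p : ℤ) ^ (w + 1) ∣ ((d * D : ℕ) : ℤ) := by
    refine h3.trans ?_
    push_cast
    rw [mul_comm (d : ℤ)]
    exact mul_dvd_mul_left _ h4
  have h7 : p ^ (w + 1) ∣ d * D := by exact_mod_cast Int.natCast_dvd_natCast.1 (by exact_mod_cast h6)
  have h8 := (hp.pow_dvd_iff_le_factorization (Nat.mul_ne_zero hd hD)).1 h7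
  omega

/-- **The inner sums are integers**: `∑_{i} d^{s+1} a_{i,k}/(ℓ + j/D)^i ∈ ℤ` for `0 ≤ ℓ ≤ k ≤ n`,
`1 ≤ j ≤ D`, and `d ≠ 0` a common multiple of `1, …, n+1` (the `p`-adic argument of the source for
`j < D`; directly for `j = D`). [cite: FischlerSprangZudilin2019, §3 proof of Lemma 2] -/
theorem exists_int_innerSum {s D n : ℕ} {c : ℕ → ℕ → ℚ} (hc : IsPF s D n c) (h3D : 3 * D ≤ s)
    (hn : 1 ≤ n) {d : ℕ} (hd : d ≠ 0) (hdiv : ∀ k : ℕ, 1 ≤ k → k ≤ n + 1 → (k : ℤ) ∣ d) {j : ℕ}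
    (hj : 1 ≤ j) (hjD : j ≤ D) {k ℓ : ℕ} (hℓk : ℓ ≤ k) (hkn : k ≤ n) :
    ∃ z : ℤ, innerSum s D d c j k (ℓ : ℤ) = z := by
  have hD : 1 ≤ D := hj.trans hjD
  have hD0 : (D : ℚ) ≠ 0 := by exact_mod_cast (by omega : D ≠ 0)
  have hdiv' : ∀ k : ℕ, 1 ≤ k → k ≤ n → (k : ℤ) ∣ d := fun k h1 h2 => hdiv k h1 (by omega)
  rcases hjD.lt_or_eq with hjD' | rfl
  · -- `1 ≤ j < D`: `p`-integral for every `p`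
    refine PIntegral.exists_int_of_forall fun p hp => ?_
    by_cases hgood : (p : ℤ) ^ ((d * D).factorization p + 1) ∣ (D : ℤ) * ℓ + j
    · -- `ℓ` is bad: all other points of the window are good, use (3.5)
      have hwin := sum_innerSum_window_eq_zero hc hn d hj hjD' hℓk hkn
      rw [← add_sum_erase _ _ (mem_range.2 (Nat.lt_succ_of_le hkn))] at hwin
      have hkk : ((ℓ : ℤ) - k + k) = ℓ := by ring
      rw [hkk] at hwin
      rw [eq_neg_of_add_eq_zero_left hwin]
      refine PIntegral.neg (PIntegral.sum hp _ fun k' hk' => ?_)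
      have hk'n : k' ≤ n := Nat.lt_succ_iff.1 (mem_range.1 (mem_of_mem_erase hk'))
      have hk'k : k' ≠ k := ne_of_mem_erase hk'
      refine pIntegral_innerSum hc h3D hn hdiv' hj hjD' hp k' hk'n _ fun hbad => ?_
      refine not_two_bad hp hd (by omega) hdiv' (m₁ := (ℓ : ℤ)) (m₂ := (ℓ : ℤ) - k + k') ?_ ?_ hgood hbad
      · intro h; apply hk'k; omega
      · rw [show (ℓ : ℤ) - ((ℓ : ℤ) - k + k') = k - k' by ring]; omega
    · exact pIntegral_innerSum hc h3D hn hdiv' hj hjD' hp k hkn _ hgood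
  · -- `j = D`: directly
    obtain ⟨q, hq⟩ := hdiv (ℓ + 1) (by omega) (by omega)
    have h : ∀ o ∈ range (s + 1), ∃ z : ℤ,
        (d : ℚ) ^ (s + 1) * c o k / ((ℓ : ℤ) + (j : ℚ) / j) ^ (o + 1) = z := by
      intro o ho
      have ho' : o ≤ s := Nat.lt_succ_iff.1 (mem_range.1 ho)
      obtain ⟨z, hz⟩ := hc.isInt_coeff h3D hn hD d hdiv' o k ho' hkn
      refine ⟨z * q ^ (o + 1), ?_⟩
      have hℓ : (ℓ : ℚ) + (j : ℚ) / j = (ℓ : ℚ) + 1 := by rw [div_self hD0]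
      have hdq : (d : ℚ) = ((ℓ : ℚ) + 1) * q := by
        have := congrArg (fun x : ℤ => (x : ℚ)) hq
        push_cast at this
        linarith
      have hpow : (d : ℚ) ^ (o + 1) = ((ℓ : ℚ) + 1) ^ (o + 1) * (q : ℚ) ^ (o + 1) := by
        rw [hdq, mul_pow]
      push_cast
      rw [hℓ, ← hz, show s + 1 = (s - o) + (o + 1) by omega, pow_add, hpow]
      have hℓ0 : (ℓ : ℚ) + 1 ≠ 0 := by positivity
      field_simp
    choose! z hz using h
    refine ⟨∑ o ∈ range (s + 1), z o, ?_⟩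
    rw [innerSum]
    push_cast
    exact sum_congr rfl hz

/-- **Lemma 2, (3.2)** (PROVED): `d^{s+1} ρ_{0,j} ∈ ℤ` for every `j ∈ {1, …, D}` and every common multiple `d`
of `1, …, n+1` — in particular `d_{n+1}^{s+1} ρ_{0,j} ∈ ℤ` as printed.
[cite: FischlerSprangZudilin2019, §3 Lemma 2 eq. (3.2)] -/
theorem lemma2_rhoZero {s D n : ℕ} {c : ℕ → ℕ → ℚ} (hc : IsPF s D n c) (h3D : 3 * D ≤ s) (hn : 1 ≤ n)
    (d : ℕ) (hdiv : ∀ k : ℕ, 1 ≤ k → k ≤ n + 1 → (k : ℤ) ∣ d) (j : ℕ) (hj : 1 ≤ j) (hjD : j ≤ D) :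
    ∃ z : ℤ, (d : ℚ) ^ (s + 1) * rhoZero s D n c j = z := by
  rcases eq_or_ne d 0 with rfl | hd
  · exact ⟨0, by simp⟩
  have h : ∀ k ∈ range (n + 1), ∀ ℓ ∈ range (k + 1), ∃ z : ℤ, innerSum s D d c j k (ℓ : ℤ) = z := by
    intro k hk ℓ hℓ
    exact exists_int_innerSum hc h3D hn hd hdiv hj hjD (Nat.lt_succ_iff.1 (mem_range.1 hℓ))
      (Nat.lt_succ_iff.1 (mem_range.1 hk))
  choose! z hz using h
  refine ⟨-∑ k ∈ range (n + 1), ∑ ℓ ∈ range (k + 1), z k ℓ, ?_⟩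
  rw [pow_mul_rhoZero_eq]
  push_cast
  congr 1
  exact sum_congr rfl fun k hk => sum_congr rfl fun ℓ hℓ => hz k hk ℓ hℓ

/-! ### The top-order coefficients vanish: `a_{s+1,k} = 0` -/

/-- **`a_{s+1,k} = 0`**: the expansion (2.1) really stops at `i = s`, because the numerator
`∏_j (t - n + j/D)` of `R_n` vanishes at every pole `t = -k` (`j = D(n+k)`), so the poles have order `≤ s`.
(Clear denominators: the polynomial `pfEval(t)·∏_q (t+q+1)^{s+1}` agrees with the numerator polynomial at
infinitely many points; evaluate at the pole.) [cite: FischlerSprangZudilin2019, §2 eq. (2.1)] -/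
theorem IsPF.top_eq_zero {s D n : ℕ} {c : ℕ → ℕ → ℚ} (hc : IsPF s D n c) (hD : 1 ≤ D) (p₀ : ℕ)
    (hp₀ : p₀ ≤ n) : c s p₀ = 0 := by
  classical
  have hD0 : (D : ℚ) ≠ 0 := by exact_mod_cast (by omega : D ≠ 0)
  set Q : ℚ[X] := ∑ p ∈ range (n + 1), ∑ o ∈ range (s + 1),
      C (c o p) * ((X + C (p : ℚ) + 1) ^ (s - o) *
        ∏ q ∈ (range (n + 1)).erase p, (X + C (q : ℚ) + 1) ^ (s + 1)) with hQ
  set N : ℚ[X] := C ((D : ℚ) ^ (3 * D * n) * (n.factorial : ℚ) ^ (s + 1 - 3 * D)) *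
      ∏ j ∈ range (3 * D * n + 1), (X + C (1 - (n : ℚ) + (j : ℚ) / D)) with hN
  have hQeval : ∀ t : ℚ, Q.eval t = ∑ p ∈ range (n + 1), ∑ o ∈ range (s + 1),
      c o p * ((t + p + 1) ^ (s - o) * ∏ q ∈ (range (n + 1)).erase p, (t + q + 1) ^ (s + 1)) := by
    intro t
    simp only [hQ, eval_finsetSum, eval_mul, eval_C, eval_pow, eval_add, eval_X, eval_one,
      eval_prod]
  have hNeval : ∀ t : ℚ, N.eval t = (D : ℚ) ^ (3 * D * n) * (n.factorial : ℚ) ^ (s + 1 - 3 * D) *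
      ∏ j ∈ range (3 * D * n + 1), (t + 1 - n + (j : ℚ) / D) := by
    intro t
    simp only [hN, eval_mul, eval_C, eval_prod, eval_add, eval_X]
    congr 1
    exact prod_congr rfl fun j _ => by ring
  -- `Q = N` at every natural `t`
  have hQN : ∀ t : ℕ, (Q - N).eval (t : ℚ) = 0 := by
    intro t
    have hpos : ∀ m : ℕ, m ≤ n → (t : ℚ) + m + 1 ≠ 0 := fun m _ => by positivity
    have hP : ∏ q ∈ range (n + 1), ((t : ℚ) + q + 1) ^ (s + 1) ≠ 0 :=
      prod_ne_zero_iff.2 fun q _ => pow_ne_zero _ (by positivity)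
    have e : Q.eval (t : ℚ) =
        pfEval n (s + 1) c t * ∏ q ∈ range (n + 1), ((t : ℚ) + q + 1) ^ (s + 1) := by
      rw [hQeval, pfEval, sum_mul]
      refine sum_congr rfl fun p hp => ?_
      rw [sum_mul]
      refine sum_congr rfl fun o ho => ?_
      have ho' : o ≤ s := Nat.lt_succ_iff.1 (mem_range.1 ho)
      rw [← mul_prod_erase _ _ hp]
      have hsplit : ((t : ℚ) + p + 1) ^ (s + 1) = ((t : ℚ) + p + 1) ^ (o + 1) * ((t : ℚ) + p + 1) ^ (s - o) := by
        rw [← pow_add]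
        congr 1
        omega
      rw [hsplit]
      have := hpos p (Nat.lt_succ_iff.1 (mem_range.1 hp))
      field_simp
    have e2 : N.eval (t : ℚ) = R s D n (t + 1) * ∏ q ∈ range (n + 1), ((t : ℚ) + q + 1) ^ (s + 1) := by
      rw [hNeval, R, ← prod_pow]
      have : ∏ q ∈ range (n + 1), ((t : ℚ) + 1 + q) ^ (s + 1) =
          ∏ q ∈ range (n + 1), ((t : ℚ) + q + 1) ^ (s + 1) :=
        prod_congr rfl fun q _ => by ring
      rw [this]
      field_simp
    rw [eval_sub, e, e2, hc t hpos, sub_self]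
  have hQN0 : Q - N = 0 := by
    apply Polynomial.eq_zero_of_infinite_isRoot
    apply Set.infinite_of_not_bddAbove
    rintro ⟨B, hB⟩
    set t : ℕ := ⌈B⌉₊ + 1 with ht
    have hroot : (t : ℚ) ∈ {x | (Q - N).IsRoot x} := by
      simp only [Set.mem_setOf_eq, IsRoot.def]
      exact hQN t
    have h1 : (t : ℚ) ≤ B := hB hroot
    have h2 : B < t := by
      rw [ht]; push_cast; linarith [Nat.le_ceil B]
    linarith
  -- evaluate at the pole `-p₀-1`
  have hev : Q.eval (-(p₀ : ℚ) - 1) =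
      c s p₀ * ∏ q ∈ (range (n + 1)).erase p₀, (-(p₀ : ℚ) - 1 + q + 1) ^ (s + 1) := by
    rw [hQeval, sum_eq_single p₀, sum_eq_single s]
    · have : (-(p₀ : ℚ) - 1 + p₀ + 1) ^ (s - s) = 1 := by simp
      rw [this, one_mul]
    · intro o ho hne
      have ho' : o < s := lt_of_le_of_ne (Nat.lt_succ_iff.1 (mem_range.1 ho)) hne
      have : (-(p₀ : ℚ) - 1 + p₀ + 1) ^ (s - o) = 0 := by
        rw [show (-(p₀ : ℚ) - 1 + p₀ + 1) = 0 by ring, zero_pow (by omega)]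
      rw [this, zero_mul, mul_zero]
    · intro hK
      exact absurd (mem_range.2 (Nat.lt_succ_self s)) hK
    · intro p hp hne
      refine sum_eq_zero fun o _ => ?_
      have hmem : p₀ ∈ (range (n + 1)).erase p :=
        mem_erase.2 ⟨hne.symm, mem_range.2 (Nat.lt_succ_of_le hp₀)⟩
      rw [prod_eq_zero hmem (by rw [show (-(p₀ : ℚ) - 1 + p₀ + 1) = 0 by ring, zero_pow (by omega)]),
        mul_zero, mul_zero]
    · intro hp
      exact absurd (mem_range.2 (Nat.lt_succ_of_le hp₀)) hp
  have hNev : N.eval (-(p₀ : ℚ) - 1) = 0 := by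
    rw [hNeval]
    have : ∏ j ∈ range (3 * D * n + 1), (-(p₀ : ℚ) - 1 + 1 - n + (j : ℚ) / D) = 0 := by
      refine prod_eq_zero (i := D * (n + p₀)) (mem_range.2 (by nlinarith)) ?_
      push_cast
      field_simp
      ring
    rw [this, mul_zero]
  have hprod : ∏ q ∈ (range (n + 1)).erase p₀, (-(p₀ : ℚ) - 1 + q + 1) ^ (s + 1) ≠ 0 := by
    refine prod_ne_zero_iff.2 fun q hq => pow_ne_zero _ ?_
    have hne : q ≠ p₀ := (mem_erase.1 hq).1
    intro h0
    apply hne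
    exact_mod_cast (by linarith : (q : ℚ) = p₀)
  have h0 : Q.eval (-(p₀ : ℚ) - 1) = 0 := by
    have := sub_eq_zero.1 hQN0
    rw [this, hNev]
  rw [hev] at h0
  exact (mul_eq_zero.1 h0).resolve_right hprod

/-- **`ρ_{0,j}` as printed** (upper limit `i = s`): the `i = s+1` terms of `rhoZero` vanish.
[cite: FischlerSprangZudilin2019, §2 Lemma 1 eq. (2.2)] -/
theorem rhoZero_eq_printed {s D n : ℕ} {c : ℕ → ℕ → ℚ} (hc : IsPF s D n c) (hD : 1 ≤ D) (j : ℕ) :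
    rhoZero s D n c j = -∑ k ∈ range (n + 1), ∑ ℓ ∈ range (k + 1), ∑ o ∈ range s,
      c o k / ((ℓ : ℚ) + (j : ℚ) / D) ^ (o + 1) := by
  rw [rhoZero]
  congr 1
  refine sum_congr rfl fun k hk => sum_congr rfl fun ℓ _ => ?_
  rw [sum_range_succ, hc.top_eq_zero hD k (Nat.lt_succ_iff.1 (mem_range.1 hk)), zero_div, add_zero]

/-- **`ρ_{s+1} = 0`** (so Lemma 2 (3.1) and Lemma 1 involve only `i ≤ s`). [cite: FischlerSprangZudilin2019, §2 eq. (2.1)] -/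
theorem rho_top_eq_zero {s D n : ℕ} {c : ℕ → ℕ → ℚ} (hc : IsPF s D n c) (hD : 1 ≤ D) :
    rho n c (s + 1) = 0 := by
  rw [rho]
  exact sum_eq_zero fun k hk => by
    rw [Nat.add_sub_cancel]; exact hc.top_eq_zero hD k (Nat.lt_succ_iff.1 (mem_range.1 hk))

/-! ### The printed forms with `d_n = lcm(1, …, n)` (Mathlib `Nat.lcmUpto`) -/

/-- `k ∣ lcm(1, …, N)` in `ℤ` for `1 ≤ k ≤ N`. [folklore] -/
private theorem natCast_dvd_lcmUpto' {k N : ℕ} (h1 : 1 ≤ k) (hN : k ≤ N) : (k : ℤ) ∣ (Nat.lcmUpto N : ℤ) := by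
  rw [Int.natCast_dvd_natCast, Nat.lcmUpto]
  exact Finset.dvd_lcm (Finset.mem_Icc.2 ⟨h1, hN⟩)

/-- **Lemma 2 (3.1) as printed**: `d_n^{s+1-i} ρ_i ∈ ℤ` (`1 ≤ i ≤ s+1`, in particular `i = 3, 5, …, s`).
[cite: FischlerSprangZudilin2019, §3 Lemma 2 eq. (3.1)] -/
theorem lemma2_rho_lcm {s D n : ℕ} {c : ℕ → ℕ → ℚ} (hc : IsPF s D n c) (h3D : 3 * D ≤ s) (hn : 1 ≤ n)
    (hD : 1 ≤ D) (i : ℕ) (hi1 : 1 ≤ i) (hi : i ≤ s + 1) :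
    ∃ z : ℤ, (Nat.lcmUpto n : ℚ) ^ (s + 1 - i) * rho n c i = z :=
  lemma2_rho hc h3D hn hD (Nat.lcmUpto n) (fun _ h1 h2 => natCast_dvd_lcmUpto' h1 h2) i hi1 hi

/-- **Lemma 2 (3.2) as printed**: `d_{n+1}^{s+1} ρ_{0,j} ∈ ℤ` for `j ∈ {1, …, D}`.
[cite: FischlerSprangZudilin2019, §3 Lemma 2 eq. (3.2)] -/
theorem lemma2_rhoZero_lcm {s D n : ℕ} {c : ℕ → ℕ → ℚ} (hc : IsPF s D n c) (h3D : 3 * D ≤ s)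
    (hn : 1 ≤ n) (j : ℕ) (hj : 1 ≤ j) (hjD : j ≤ D) :
    ∃ z : ℤ, (Nat.lcmUpto (n + 1) : ℚ) ^ (s + 1) * rhoZero s D n c j = z :=
  lemma2_rhoZero hc h3D hn (Nat.lcmUpto (n + 1)) (fun _ h1 h2 => natCast_dvd_lcmUpto' h1 h2) j hj hjD

/-! ### Bridge to the tree's `OddZeta.Rfun` (Ball–Rivoal parameter `r = 1`) -/

/-- **Same function as the tree's `OddZeta.Rfun` at `r = 1`**: `(R_n(t) : ℝ) = OddZeta.Rfun 1 D s n t` for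
rational `t` (the source's Remark 1: "one can implement an additional parameter `r` in the definition of the
rational function `R_n(t)`"; `OddZetaSeries.lean` does, this file takes the printed `r = 1`).
[cite: FischlerSprangZudilin2019, §2 (definition of R_n) and Remark 1] -/
theorem R_cast_eq_Rfun (s D n : ℕ) (t : ℚ) :
    ((R s D n t : ℚ) : ℝ) = Literature.NumberTheory.Transcendental.OddZeta.Rfun 1 D s n (t : ℝ) := by
  rw [R, Literature.NumberTheory.Transcendental.OddZeta.Rfun, Literature.NumberTheory.Transcendental.OddZeta.Lnum,
    show (2 * 1 + 1) * D * n = 3 * D * n by ring, show s + 1 - (2 * 1 + 1) * D = s + 1 - 3 * D by norm_num,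
    ← prod_pow]
  push_cast
  simp only [one_mul]

/-- The tree's `OddZeta.hz` and `DirichletLValues.hurwitzValue` are the same real Hurwitz value
`ζ(i, α) = ∑_{ν ≥ 0} (ν+α)^{-i}` of the source. [cite: FischlerSprangZudilin2019, §2 (definition of ζ(i,α))] -/
theorem hz_eq_hurwitzValue (i : ℕ) (α : ℝ) :
    Literature.NumberTheory.Transcendental.OddZeta.hz i α = hurwitzValue i α := rfl

/-- `r_{n,j}` through the tree's `OddZeta.Rfun`: `r_{n,j} = ∑_{m ≥ 0} Rfun 1 D s n (m + 1 + j/D)`.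
[cite: FischlerSprangZudilin2019, §2 (definition of r_{n,j})] -/
theorem r_eq_tsum_Rfun (s D n j : ℕ) :
    r s D n j = ∑' m : ℕ, Literature.NumberTheory.Transcendental.OddZeta.Rfun 1 D s n ((m : ℝ) + 1 + (j : ℝ) / D) := by
  rw [r]
  refine tsum_congr fun m => ?_
  rw [R_cast_eq_Rfun]
  push_cast
  rfl

end Literature.NumberTheory.Irrationality.FischlerSprangZudilin2019
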